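import Literature.Geometry.Kaehler.CyclotomicDegreeTwelveCMTypeRankTable
import Literature.AlgebraicGeometry.ComplexMultiplication.CyclotomicCMTypeCensusThirtyTwo
import HarnessLib

/-!
# `ℚ(ζ₃₂)` (`φ = 16`): the RANK TABLE `9 ∕ 8 ∕ 7 ∕ 5 ∕ 3 ∕ 2` of its `256` CM types, the Hodge conjecture for all powers of the abelian
# varieties of the `160` types OFF the 6 degenerate primitive families, SIMPLE CM `8`-FOLDS WITH `B⁴ ≠ D⁴` or `B² ≠ D²` for the `96` types ON them,
# and the complex `8`-tori with an endomorphism of characteristic polynomial `Φ₃₂`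

Layer `Literature/Geometry/Kaehler`, namespace `Literature.Geometry.Kaehler.ComplexTorus`; lane `lit-hodgefound` (Track 2 foundations
library), prover seat `lit-hodgefound-p10`, generation 34 (addendum), row «A2-26 (ℚ(ζ₃₂) Hodge)» (self-proposed 2026-08-28).  Theorems only; no
`def`, no instance, no named fact (net Literature debt 0).  The cyclotomic fields of degree `16` (`d ∈ {17, 32, 34, 40, 48, 60}`) all have a
`2`-GROUP as Galois group; `ℚ(ζ₁₇) = ℚ(ζ₃₄)` (cyclic: every type nondegenerate) is the tree's `CyclicTwoPowerCMTypesFermat`; this file treats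
`ℚ(ζ₃₂)`, `(ℤ/32)ˣ ≅ C₂ × C₈`, where degenerate PRIMITIVE types occur (`{1, 3, 5, 7, 9, 13, 17, 21}`: rank `8`; `{1, 3, 5, 7, 13, 15, 21, 23}`: rank `8`; `{1, 3, 5, 13, 17, 21, 23, 25}`: rank `8`; `{1, 7, 13, 15, 21, 23, 27, 29}`: rank `8`; `{1, 3, 5, 9, 11, 13, 17, 25}`: rank `7`; `{1, 7, 9, 11, 13, 15, 27, 29}`: rank `7`).  Lenstra's types of Gordon §9.4.2 are among the representatives:
`S = {1, 7, 13, 15, 21, 23, 27, 29}` has rank EXACTLY `8` (Weil type `(4,4)` over `ℚ(i)`), and `S' = {1, 7, 9, 11, 13, 15, 27, 29}` — Green–Griffiths–Kerr's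
Example (V.A.6)(i), «`R(L,Θ) − 1 = 6`» in (V.D.8) — has rank EXACTLY `7`.

INPUT: the census `CyclotomicCMTypeCensusThirtyTwo` (20 families sorted «not coset-balanced ∕ free & balanced ∕ not free»; the maximal
`(−1)`-free subgroups; the balance of the representatives), `Pohlmann1968/CyclotomicCosetBalancedCMTypes` (Yanai at full strength on residues:
`cmTypeRank_add_le_of_cosetBalanced`; Mumford–Pohlmann: `exists_exceptional_of_cosetBalanced`) and explicit rank certificates.

* §0 GENERIC (any `ℚ(ζ_N)`, `N > 2`; sequels of `CyclotomicDegreeTwelveCMTypeRankTable.cmTypeRank_eq_succ_of_card_stabilizer_mul_eq`): with `W`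
  the residue stabiliser of `Φ` and `|W| · 2k = φ(N)` (`Φ` is induced from its primitive sub-pair `(K₁, Φ₁)`, `[K₁ : ℚ] = 2k`):
  **`cmTypeRank_le_succ_of_card_stabilizer_mul_eq`** (`Rank(Φ) = Rank(Φ₁) ≤ k + 1`); and when `Rank(Φ) = k + 1` (so `Φ₁` is NONDEGENERATE):
  **`hodgeClassSpan_pow_eq_divisorClassesSpan_of_card_stabilizer_mul_eq`** (`B•(Aⁿ) ⊗ ℂ = D•(Aⁿ) ⊗ ℂ` for every realisation, Hazama's
  criterion `IsNondegenerate.hodgeClassSpan_pow_eq_divisorClassesSpan_inducedCMType`), **`hodgeConjectureFor_pow_of_card_stabilizer_mul_eq`**,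
  and the torus form **`divisorClasses_powPeriod_periodIso_eq_hodgeClasses_of_card_stabilizer_mul_eq`** (`Hdg = Div` on all powers of
  `ℂ^g/Φ(𝔞) ∼ (ℂ^{g₁}/Φ₁(𝒪))^{|W|}`).
* §1 RANKS: lower bounds by explicit invertible minors of the `16 × 16` translate matrix `([u·c ∈ S])` (`9 × 9` for the eight not
  coset-balanced representatives, `8 × 8`, `8 × 8`, `8 × 8`, `8 × 8`, `7 × 7`, `7 × 7` for the degenerate primitive ones, `5 × 5` for the
  representatives with stabiliser of order `2`), upper bounds by Kubota (`≤ 9`), Yanai (`rank + m ≤ 9` when balanced for `W`, `|W|·2m = 16`)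
  and the induced-type bound; **`cmTypeRank_eq_nine_of_not_cosetBalanced_thirtyTwo`**, **`cmTypeRank_of_isPrimitive_of_cosetBalanced_thirtyTwo`**,
  **`cmTypeRank_of_not_isPrimitive_thirtyTwo`** (`5 ∕ 3 ∕ 2` by stabiliser order `2 ∕ 4 ∕ 8`), `cmTypeRank_mem_thirtyTwo`, **`isNondegenerate_iff_not_cosetBalanced_thirtyTwo`**,
  `isPrimitive_iff_seven_le_cmTypeRank_thirtyTwo`, `ncard_isNondegenerate_thirtyTwo` (`128`).
* §2 VARIETIES of type `(ℚ(ζ₃₂); Φ)` (all of dimension `8`): **`hodgeClassSpan_pow_eq_divisorClassesSpan_of_thirtyTwo`** and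
  **`hodgeConjectureFor_pow_of_thirtyTwo`** — `B•(Aⁿ) ⊗ ℂ = D•(Aⁿ) ⊗ ℂ` and the Hodge conjecture for ALL powers whenever `Φ` is not a primitive
  coset-balanced type (`160` types: the `128` nondegenerate ones and the `32` imprimitive ones, which are induced from NONDEGENERATE types);
  **`exists_exceptional_four_of_cosetBalanced_thirtyTwo`** (primitive, balanced for a maximal `(−1)`-free subgroup of order `8` ⟹ `A` simple,
  rational `(4,4)`-classes outside `D⁴(A) ⊗ ℂ`, `dim B⁴ − dim D⁴ ≥ 2`: Weil type `(4,4)` over an imaginary quadratic subfield),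
  **`exists_exceptional_two_of_cosetBalanced_thirtyTwo`** (balanced for a `(−1)`-free subgroup of order `4` ⟹ rational `(2,2)`-classes outside
  `D²(A) ⊗ ℂ`); the DICHOTOMY **`hodgeConjectureFor_pow_or_exceptional_thirtyTwo`**; non-vacuity `exists_isSimple_exceptional_thirtyTwo`.
* §3 TORI with an endomorphism `u` of characteristic polynomial `Φ₃₂`: `mtRank_hodgeStructure_mem_thirtyTwo`, `isSimple_iff_seven_le_mtRank_thirtyTwo`,
  **`forall_divisorClasses_powPeriod_eq_hodgeClasses_iff_thirtyTwo`** (`Hdg = Div` on ALL powers ⟺ (`X` simple → `rank MT(X) = 9`)),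
  `exists_isSimple_mtRank_eq_thirtyTwo` (simple abelian `8`-folds `ℂ⁸/Φ(𝔞)` with `u = ζ₃₂` of each primitive rank).

HONEST SCOPE.  For the `96` primitive coset-balanced types the Hodge conjecture for `A` itself (algebraicity of the Weil-type classes) is NOT
asserted; what is proved is `B⁴ ≠ D⁴` resp. `B² ≠ D²` and the failure of «`Hdg = Div` on all powers».

## References

* [Gordon1999HodgeAVSurvey] B. B. Gordon, *A survey of the Hodge conjecture for abelian varieties* (1999), 5.13 (ii), Thm. 6.4, 7.5, 9.2.2, §9.3,
  §9.4.1 (Prop. 9.4.1, Kubota rank), §9.4.2 (Lenstra's `ℚ(ζ₃₂)` types), 9.4.3 (Theorem [B.140], Yanai).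
* [GreenGriffithsKerr2012] M. Green, P. Griffiths, M. Kerr, *Mumford–Tate Groups and Domains* (2012), (V.A.6)(i), (V.A.7)–(V.A.8), (V.D.8).
* [Shimura1998] G. Shimura, *Abelian Varieties with Complex Multiplication and Modular Functions* (1998), §6.2 Thm. 3, §8.2 Prop. 26, §8.4.
* [Kubota1965] T. Kubota, Trans. AMS 118 (1965), §2 p. 115, §4 Lemma 2.
* [KoblitzRohrlich1978] N. Koblitz, D. Rohrlich, Canad. J. Math. 30 (1978), §1 p. 1184 (`[L : K₁] = |W|`).
* [vanGeemen1994HodgeAV] B. van Geemen, LNM 1594 (1994), Thm. 4.5, 4.7.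
* [Pohlmann1968] H. Pohlmann, Ann. of Math. 88 (1968), Thm. 1, §3.
* [MoonenZarhin1999LowDim] B. Moonen, Yu. Zarhin, Math. Ann. 315 (1999), §2 (2.7).
-/

noncomputable section

open scoped Classical nonZeroDivisors NumberField Manifold ContDiff MatrixGroups
open NumberField Module Polynomial CategoryTheory CategoryTheory.Limits

namespace Literature.Geometry.Kaehler

namespace ComplexTorus

-- `open scoped`: the tree's action of `Aut(ℂ)` on `Hom(K, ℂ)` by composition (`ringEquivCompAction`) is a scoped instance
open scoped Literature.NumberTheory.ComplexMultiplication
open Literature.NumberTheory.Automorphic (IsTorusSubgroup)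
open Literature.AlgebraicGeometry.Motives (CMType AbelianVariety HodgeTensorFacts hodgeTensorFacts_holds)
open Literature.AlgebraicGeometry.HodgeTheory (HodgeConjectureFor complexBetti IsRationalClass IsOfHodgeType)
open Literature.AlgebraicGeometry.VanGeemen1994 (hodgeClassSpan)
open Literature.Barriers.HodgeConjecture (divisorClassesSpan)
open Literature.NumberTheory.ComplexMultiplication (IsPrimitive inducedCMType translateInd translateInd_of_mem translateInd_of_not_mem
  isPrimitive_iff_forall_eq exists_primitive_inducedCMType_eq_of_isCMField)
open Literature.NumberTheory.ComplexMultiplication.CMTypeLattice (periodIso basisIndex card_basisIndex_eq_finrank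
  isSimple_periodIso_iff_isPrimitive isAbelianVariety_periodIso isIsogenous_powPeriod_periodIso_of_basis)
open Literature.AlgebraicGeometry.Pohlmann1968 (cmTypeRank cmTypeRank_le IsNondegenerate isNondegenerate_iff cmTypeRank_inducedCMType
  isPretransitive_ringEquiv_complex)
open Literature.AlgebraicGeometry.Pohlmann1968.Cyclotomic (autExp expOf exists_autExp_eq exists_expOf_eq finrank_eq_totient
  not_isNondegenerate_of_cosetBalanced cmTypeRank_le_of_cosetBalanced cmTypeRank_add_le_of_cosetBalanced exists_exceptional_of_cosetBalanced
  two_le_finrank_hodgeClassSpan_sub_finrank_divisorClassesSpan_of_cosetBalanced cosetBalanced_of_isAutTransform)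
open Literature.AlgebraicGeometry.ComplexMultiplication (IsCMTypeRealisation isSimple_iff_isPrimitive isPrimitive_ringEquiv_complex_iff
  isSimple_of_isCMTypeRealisation_of_isPrimitive finrank_eq_card_filter_of_primitive)
open Literature.AlgebraicGeometry.ComplexMultiplication.CMTorus (mtRank_hodgeStructure_periodIso_eq_cmTypeRank)
open Literature.AlgebraicGeometry.ComplexMultiplication.CyclotomicCMTypeResidueSets (IsAutTransform IsAutTransform.symm IsAutTransform.refl
  unitResidues residueSet HasTrivialStabilizer allCMResidueSets expOf_smul expOf_mem_residueSet_iff IsAutTransform.isPrimitive_iff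
  isPrimitive_iff_hasTrivialStabilizer coprime_iff_mem_unitResidues isCMResidueSet_residueSet card_filter_allCMResidueSets_eq
  ncard_setOf_eq_card_filter_powerset_half)
open Literature.AlgebraicGeometry.ComplexMultiplication.CyclotomicCMTypeCensusThirtyTwo (isCMResidueSet_half_thirtyTwo isCMResidueSet_reps_thirtyTwo
  hasTrivialStabilizer_reps_thirtyTwo stabilizer_reps_thirtyTwo subgroups_thirtyTwo cosetBalanced_reps_thirtyTwo not_cosetBalanced_reps_thirtyTwo exists_isAutTransform_thirtyTwo
  isPrimitive_of_not_cosetBalanced_thirtyTwo card_stabilizer_of_not_isPrimitive_thirtyTwo filter_stabilizer_eq_of_isAutTransform_thirtyTwo residueSet_mem_thirtyTwo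
  exists_residueSet_eq_thirtyTwo ncard_not_cosetBalanced_thirtyTwo)

/-! ### §0 Generic: types induced from a nondegenerate sub-pair, read on the residue stabiliser (any `ℚ(ζ_N)`) -/

section Generic

variable {N : ℕ} [NeZero N] {L : Type} [Field L] [NumberField L] [IsCyclotomicExtension {N} ℚ L]

/-- The primitive sub-pair `(K₁, Φ₁)` of `Φ` has `[K₁ : ℚ] = 2k` when `|W| · 2k = φ(N)` (`[L : K₁] = |W|`, Koblitz–Rohrlich).
[cite: KoblitzRohrlich1978, §1 p. 1184] [cite: Shimura1998, §8.2 Prop. 26] -/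
private theorem finrank_sub_eq_of_card_stabilizer_mul_eq {K₁ : IntermediateField ℚ L} {Φ₁ : CMType K₁} (Φ : CMType L)
    (h₁ : inducedCMType (algebraMap K₁ L) Φ₁ = Φ)
    (hp₁ : ∀ s t : K₁ →+* ℂ, (∀ τ : ℂ ≃+* ℂ, (τ : ℂ →+* ℂ).comp s ∈ Φ₁.1 ↔ (τ : ℂ →+* ℂ).comp t ∈ Φ₁.1) → s = t) {k : ℕ}
    (hW : ((unitResidues N).filter fun t => ∀ c ∈ unitResidues N, (c * t ∈ residueSet N Φ ↔ c ∈ residueSet N Φ)).card * (2 * k) =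
      N.totient) :
    Module.finrank ℚ K₁ = 2 * k := by
  have hdeg : Module.finrank K₁ L = ((unitResidues N).filter fun t =>
      ∀ c ∈ unitResidues N, (c * t ∈ residueSet N Φ ↔ c ∈ residueSet N Φ)).card :=
    finrank_eq_card_filter_of_primitive (N := N) Φ Φ₁ h₁ hp₁
  have hmul := Module.finrank_mul_finrank ℚ K₁ L
  rw [hdeg, finrank_eq_totient N L, ← hW, mul_comm] at hmul
  have hpos : 0 < ((unitResidues N).filter fun t => ∀ c ∈ unitResidues N, (c * t ∈ residueSet N Φ ↔ c ∈ residueSet N Φ)).card := by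
    by_contra h0
    have h0' : ((unitResidues N).filter fun t => ∀ c ∈ unitResidues N, (c * t ∈ residueSet N Φ ↔ c ∈ residueSet N Φ)).card = 0 := by omega
    rw [h0', zero_mul] at hW
    exact absurd hW.symm (Nat.totient_pos.2 (NeZero.pos N)).ne'
  exact Nat.eq_of_mul_eq_mul_left hpos hmul

/-- **The induced-type bound `Rank(Φ) ≤ k + 1` when `|W| · 2k = φ(N)`** (`Rank(Φ) = Rank(Φ₁) ≤ [K₁ : ℚ]/2 + 1`, Kubota).
[cite: Kubota1965, §2 (p. 115)] [cite: KoblitzRohrlich1978, §1 p. 1184] -/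
theorem cmTypeRank_le_succ_of_card_stabilizer_mul_eq (hN : 2 < N) (Φ : CMType L) {k : ℕ}
    (hW : ((unitResidues N).filter fun t => ∀ c ∈ unitResidues N, (c * t ∈ residueSet N Φ ↔ c ∈ residueSet N Φ)).card * (2 * k) =
      N.totient) :
    cmTypeRank Φ ≤ k + 1 := by
  haveI : IsCMField L := IsCyclotomicExtension.Rat.isCMField L (S := ({N} : Set ℕ)) ⟨N, rfl, hN⟩
  obtain ⟨K₁, Φ₁, hCM, h₁, hp₁, -⟩ := exists_primitive_inducedCMType_eq_of_isCMField Φ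
  haveI := hCM
  have hK₁ := finrank_sub_eq_of_card_stabilizer_mul_eq Φ h₁ hp₁ hW
  have h := cmTypeRank_le Φ₁
  rw [hK₁] at h
  rw [← h₁, cmTypeRank_inducedCMType]
  omega

/-- When `|W| · 2k = φ(N)` and `Rank(Φ) = k + 1`, the primitive sub-type `Φ₁` is nondegenerate. [cite: Kubota1965, §2 (p. 115)]
[cite: KoblitzRohrlich1978, §1 p. 1184] -/
private theorem isNondegenerate_sub_of_card_stabilizer_mul_eq {K₁ : IntermediateField ℚ L} [IsCMField K₁] {Φ₁ : CMType K₁} (Φ : CMType L)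
    (h₁ : inducedCMType (algebraMap K₁ L) Φ₁ = Φ)
    (hp₁ : ∀ s t : K₁ →+* ℂ, (∀ τ : ℂ ≃+* ℂ, (τ : ℂ →+* ℂ).comp s ∈ Φ₁.1 ↔ (τ : ℂ →+* ℂ).comp t ∈ Φ₁.1) → s = t) {k : ℕ}
    (hW : ((unitResidues N).filter fun t => ∀ c ∈ unitResidues N, (c * t ∈ residueSet N Φ ↔ c ∈ residueSet N Φ)).card * (2 * k) =
      N.totient) (hr : cmTypeRank Φ = k + 1) :
    IsNondegenerate Φ₁ := by
  have hK₁ := finrank_sub_eq_of_card_stabilizer_mul_eq Φ h₁ hp₁ hW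
  have hr₁ : cmTypeRank Φ₁ = k + 1 := by rw [← hr, ← h₁, cmTypeRank_inducedCMType]
  rw [isNondegenerate_iff, hK₁, hr₁]
  omega

variable {A : AbelianVariety ℂ} {ι : 𝓞 L →+* End A} {θ : L →+* Module.End ℂ (complexBetti A.X 1)}

/-- **`Bᵐ(Aⁿ) ⊗ ℂ = Dᵐ(Aⁿ) ⊗ ℂ` for every realisation of a type of `ℚ(ζ_N)` with `|W| · 2k = φ(N)` and `Rank = k + 1`** (induced from a
NONDEGENERATE sub-type; Hazama's criterion). [cite: Gordon1999HodgeAVSurvey, Thm. 6.4 and §9.3] [cite: Kubota1965, §2 (p. 115)] -/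
theorem hodgeClassSpan_pow_eq_divisorClassesSpan_of_card_stabilizer_mul_eq (hN : 2 < N) (Φ : CMType L) {k : ℕ}
    (hW : ((unitResidues N).filter fun t => ∀ c ∈ unitResidues N, (c * t ∈ residueSet N Φ ↔ c ∈ residueSet N Φ)).card * (2 * k) =
      N.totient) (hr : cmTypeRank Φ = k + 1) (hA : IsCMTypeRealisation Φ A ι θ) (n m : ℕ) :
    hodgeClassSpan (⨁ fun _ : Fin n => A).dim (⨁ fun _ : Fin n => A).X m =
      divisorClassesSpan (⨁ fun _ : Fin n => A).X (⨁ fun _ : Fin n => A).dim m := by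
  haveI : IsCMField L := IsCyclotomicExtension.Rat.isCMField L (S := ({N} : Set ℕ)) ⟨N, rfl, hN⟩
  obtain ⟨K₁, Φ₁, hCM, h₁, hp₁, -⟩ := exists_primitive_inducedCMType_eq_of_isCMField Φ
  haveI := hCM
  exact (isNondegenerate_sub_of_card_stabilizer_mul_eq Φ h₁ hp₁ hW hr).hodgeClassSpan_pow_eq_divisorClassesSpan_inducedCMType h₁ hA n m

/-- `Bᵐ ⊗ ℂ = Dᵐ ⊗ ℂ` for all `m` on an abelian variety gives the Hodge conjecture for it. [cite: Gordon1999HodgeAVSurvey, §9.3] -/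
private theorem hodgeConjectureFor_of_forall_hodgeClassSpan_eq₈₀ (B : AbelianVariety ℂ)
    (h : ∀ m : ℕ, hodgeClassSpan B.dim B.X m = divisorClassesSpan B.X B.dim m) : HodgeConjectureFor B.dim B.X :=
  ⟨Literature.AlgebraicGeometry.HodgeTheory.nonempty_hodgeModel_holds
      (Literature.AlgebraicGeometry.Motives.AbelianVariety.isSmoothProjective_holds (A := B)),
    fun m _ hc hmm ↦ Literature.AlgebraicGeometry.HodgeTheory.AbelianVariety.divisorClassesSpan_le_algebraicClasses B
      (fun b hb hb' ↦ Literature.AlgebraicGeometry.HodgeTheory.lefschetzOneOne_rational_holds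
        (Literature.AlgebraicGeometry.Motives.AbelianVariety.isSmoothProjective_holds (A := B)) b hb hb') m
      ((h m) ▸ Submodule.subset_span ⟨hc, hmm⟩)⟩

/-- **The Hodge conjecture for every power of every realisation of a type of `ℚ(ζ_N)` with `|W| · 2k = φ(N)` and `Rank = k + 1`.**
[cite: Gordon1999HodgeAVSurvey, Thm. 6.4 and §9.3] -/
theorem hodgeConjectureFor_pow_of_card_stabilizer_mul_eq (hN : 2 < N) (Φ : CMType L) {k : ℕ}
    (hW : ((unitResidues N).filter fun t => ∀ c ∈ unitResidues N, (c * t ∈ residueSet N Φ ↔ c ∈ residueSet N Φ)).card * (2 * k) =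
      N.totient) (hr : cmTypeRank Φ = k + 1) (hA : IsCMTypeRealisation Φ A ι θ) (n : ℕ) :
    HodgeConjectureFor (⨁ fun _ : Fin n => A).dim (⨁ fun _ : Fin n => A).X :=
  hodgeConjectureFor_of_forall_hodgeClassSpan_eq₈₀ _ fun m => hodgeClassSpan_pow_eq_divisorClassesSpan_of_card_stabilizer_mul_eq hN Φ hW hr hA n m

/-- **`Hdg(Xᵏ) = Div(Xᵏ)` for all `k`, for the tori `X = ℂ^g/Φ(𝔞)` of a type of `ℚ(ζ_N)` with `|W| · 2k = φ(N)` and `Rank = k + 1`**: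
`X ∼ (ℂ^{k}/Φ₁(𝒪))^{|W|}` with `Φ₁` primitive nondegenerate, and for the simple abelian variety `ℂ^k/Φ₁(𝒪)` with its Mumford–Tate torus
«`Hdg = Div` on all powers ⟺ `rank MT = dim + 1`». [cite: Shimura1998, §6.2 Thm. 3] [cite: Gordon1999HodgeAVSurvey, 7.5 and §9.3] -/
theorem divisorClasses_powPeriod_periodIso_eq_hodgeClasses_of_card_stabilizer_mul_eq (hN : 2 < N) (Φ : CMType L) {k : ℕ}
    (hW : ((unitResidues N).filter fun t => ∀ c ∈ unitResidues N, (c * t ∈ residueSet N Φ ↔ c ∈ residueSet N Φ)).card * (2 * k) =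
      N.totient) (hr : cmTypeRank Φ = k + 1) (I : (FractionalIdeal (𝓞 L)⁰ L)ˣ) (j p : ℕ) :
    divisorClasses (powPeriod (periodIso Φ I) j) p = hodgeClasses (powPeriod (periodIso Φ I) j) p := by
  haveI : HodgeTensorFacts.{0, 0} := hodgeTensorFacts_holds.{0, 0}
  haveI : IsCMField L := IsCyclotomicExtension.Rat.isCMField L (S := ({N} : Set ℕ)) ⟨N, rfl, hN⟩
  obtain ⟨K₁, Φ₁, hCM, h₁, hp₁, -⟩ := exists_primitive_inducedCMType_eq_of_isCMField Φ
  haveI := hCM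
  obtain ⟨s₀⟩ : Nonempty (K₁ →+* ℂ) := inferInstance
  have hS : ComplexTorus.IsSimple (periodIso Φ₁ (1 : (FractionalIdeal (𝓞 K₁)⁰ K₁)ˣ)) :=
    (isSimple_periodIso_iff_isPrimitive Φ₁ 1 s₀).2 ((isPrimitive_ringEquiv_complex_iff Φ₁ s₀).2 hp₁)
  have hY := isAbelianVariety_periodIso Φ₁ (1 : (FractionalIdeal (𝓞 K₁)⁰ K₁)ˣ)
  have hK₁ := finrank_sub_eq_of_card_stabilizer_mul_eq Φ h₁ hp₁ hW
  have hnd := isNondegenerate_sub_of_card_stabilizer_mul_eq Φ h₁ hp₁ hW hr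
  have hdeg : Module.finrank K₁ L = ((unitResidues N).filter fun t =>
      ∀ c ∈ unitResidues N, (c * t ∈ residueSet N Φ ↔ c ∈ residueSet N Φ)).card :=
    finrank_eq_card_filter_of_primitive (N := N) Φ Φ₁ h₁ hp₁
  have hpos : 0 < Module.finrank K₁ L := Module.finrank_pos
  have hiso := IsIsogenous.symm _ _ (isIsogenous_powPeriod_periodIso_of_basis h₁ (Module.finBasis K₁ L) I 1)
  haveI : Nonempty (basisIndex (1 : (FractionalIdeal (𝓞 K₁)⁰ K₁)ˣ)) :=
    Fintype.card_pos_iff.1 (by rw [card_basisIndex_eq_finrank]; exact Module.finrank_pos)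
  refine (forall_powPeriod_divisorClasses_eq_hodgeClasses_iff_of_isIsogenous_powPeriod hY hpos hiso).2 (fun j' p' ↦ ?_) j p
  refine (hY.forall_powPeriod_divisorClasses_eq_hodgeClasses_iff_mtRank_eq_card_of_isSimple_of_isTorusSubgroup_mumfordTateGroupC hS
    (isTorusSubgroup_mumfordTateGroupC_periodIso Φ₁ 1)).2 ?_ j' p'
  rw [mtRank_hodgeStructure_periodIso_eq_cmTypeRank Φ₁ 1, card_basisIndex_eq_finrank, (isNondegenerate_iff Φ₁).1 hnd]

end Generic

/-! ### §1 The ranks of the CM types of `ℚ(ζ₃₂)` -/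

section Types

variable {K : Type} [Field K] [NumberField K]

variable [IsCyclotomicExtension {32} ℚ K]

variable (K) in
/-- `ℚ(ζ₃₂)` is a CM field (Mathlib). No instance is registered. [folklore] -/
private theorem isCMField₈ : IsCMField K :=
  IsCyclotomicExtension.Rat.isCMField K (S := ({32} : Set ℕ)) ⟨32, rfl, by norm_num⟩

variable (K) in
/-- `[ℚ(ζ₃₂) : ℚ] = 16`. [folklore] -/
private theorem finrank_eq_sixteen₈ : finrank ℚ K = 16 := by
  rw [finrank_eq_totient 32 K]; decide +kernel

/-- The indicator of a translate of `Φ`, read on exponents. [cite: Shimura1998, §8.4 Example (1)] -/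
private theorem translateInd_eq_ite₈ (Φ : CMType K) (τ : ℂ ≃+* ℂ) (σ : K →+* ℂ) :
    translateInd Φ.1 τ σ = if autExp 32 τ * expOf 32 K σ ∈ residueSet 32 Φ then (1 : ℚ) else 0 := by
  have h : τ • σ ∈ Φ.1 ↔ autExp 32 τ * expOf 32 K σ ∈ residueSet 32 Φ := by
    rw [← expOf_mem_residueSet_iff 32 Φ, expOf_smul]
  by_cases hm : autExp 32 τ * expOf 32 K σ ∈ residueSet 32 Φ
  · rw [translateInd_of_mem (h.2 hm), if_pos hm]
  · rw [translateInd_of_not_mem (fun h' => hm (h.1 h')), if_neg hm]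

/-- **`Rank(Φ) ≥ 9` for the type with residue set `{1, 3, 5, 7, 9, 11, 13, 17}`** (`N1`): the translates by the automorphisms of `ℂ` with cyclotomic characters
`1, 3, 5, 7, 9, 11, 13, 15, 17`, read at the embeddings with exponents `1, 3, 5, 7, 9, 11, 13, 15, 17`, are linearly independent (the `9 × 9` minor of
`([u·c ∈ S])` has determinant `-18`). [cite: Kubota1965, §2 (p. 115)] [cite: GreenGriffithsKerr2012, (V.A.7)–(V.A.8)] -/
private theorem nine_le_cmTypeRank_of_residueSet_eq_N1_thirtyTwo (Φ : CMType K) (hΦ : residueSet 32 Φ = {1, 3, 5, 7, 9, 11, 13, 17}) :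
    9 ≤ cmTypeRank Φ := by
  classical
  have hu : ∀ i : Fin 9, ((![1, 3, 5, 7, 9, 11, 13, 15, 17] : Fin 9 → ZMod 32) i).val.Coprime 32 := by decide
  have hc : ∀ j : Fin 9, ((![1, 3, 5, 7, 9, 11, 13, 15, 17] : Fin 9 → ZMod 32) j).val.Coprime 32 := by decide
  choose τ hτ using fun i : Fin 9 => exists_autExp_eq 32 _ (hu i)
  choose σ hσ using fun j : Fin 9 => exists_expOf_eq 32 K _ (hc j)
  let f : Fin 9 → (K →+* ℂ) → ℚ := fun i => translateInd Φ.1 (τ i)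
  have hval : ∀ i j : Fin 9, f i (σ j) =
      if (![1, 3, 5, 7, 9, 11, 13, 15, 17] : Fin 9 → ZMod 32) i * (![1, 3, 5, 7, 9, 11, 13, 15, 17] : Fin 9 → ZMod 32) j ∈
        ({1, 3, 5, 7, 9, 11, 13, 17} : Finset (ZMod 32)) then (1 : ℚ) else 0 := by
    intro i j
    show translateInd Φ.1 (τ i) (σ j) = _
    rw [translateInd_eq_ite₈, hτ, hσ, hΦ]
  have hli : LinearIndependent ℚ f := by
    rw [Fintype.linearIndependent_iff]
    intro g hg
    have heval : ∀ j : Fin 9, ∑ i, g i * f i (σ j) = 0 := fun j => by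
      have := congrFun hg (σ j)
      simpa only [Finset.sum_apply, Pi.smul_apply, smul_eq_mul, Pi.zero_apply] using this
    have e0 := heval 0
    have e1 := heval 1
    have e2 := heval 2
    have e3 := heval 3
    have e4 := heval 4
    have e5 := heval 5
    have e6 := heval 6
    have e7 := heval 7
    have e8 := heval 8
    simp (config := { decide := true }) [Fin.sum_univ_succ, hval] at e0 e1 e2 e3 e4 e5 e6 e7 e8
    intro i
    fin_cases i <;> simp <;> linarith
  have h1 : Module.finrank ℚ (Submodule.span ℚ (Set.range f)) = 9 := by
    rw [finrank_span_eq_card hli, Fintype.card_fin]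
  have h2 : Submodule.span ℚ (Set.range f) ≤
      Submodule.span ℚ (Set.range fun g : ℂ ≃+* ℂ => translateInd Φ.1 g) :=
    Submodule.span_mono (by rintro _ ⟨i, rfl⟩; exact ⟨τ i, rfl⟩)
  have h3 := Submodule.finrank_mono h2
  rw [h1] at h3
  exact h3

/-- **`Rank(Φ) ≥ 9` for the type with residue set `{1, 3, 5, 7, 9, 11, 15, 19}`** (`N2`): the translates by the automorphisms of `ℂ` with cyclotomic characters
`1, 3, 5, 7, 9, 11, 13, 15, 17`, read at the embeddings with exponents `1, 3, 5, 7, 9, 11, 13, 15, 17`, are linearly independent (the `9 × 9` minor of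
`([u·c ∈ S])` has determinant `18`). [cite: Kubota1965, §2 (p. 115)] [cite: GreenGriffithsKerr2012, (V.A.7)–(V.A.8)] -/
private theorem nine_le_cmTypeRank_of_residueSet_eq_N2_thirtyTwo (Φ : CMType K) (hΦ : residueSet 32 Φ = {1, 3, 5, 7, 9, 11, 15, 19}) :
    9 ≤ cmTypeRank Φ := by
  classical
  have hu : ∀ i : Fin 9, ((![1, 3, 5, 7, 9, 11, 13, 15, 17] : Fin 9 → ZMod 32) i).val.Coprime 32 := by decide
  have hc : ∀ j : Fin 9, ((![1, 3, 5, 7, 9, 11, 13, 15, 17] : Fin 9 → ZMod 32) j).val.Coprime 32 := by decide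
  choose τ hτ using fun i : Fin 9 => exists_autExp_eq 32 _ (hu i)
  choose σ hσ using fun j : Fin 9 => exists_expOf_eq 32 K _ (hc j)
  let f : Fin 9 → (K →+* ℂ) → ℚ := fun i => translateInd Φ.1 (τ i)
  have hval : ∀ i j : Fin 9, f i (σ j) =
      if (![1, 3, 5, 7, 9, 11, 13, 15, 17] : Fin 9 → ZMod 32) i * (![1, 3, 5, 7, 9, 11, 13, 15, 17] : Fin 9 → ZMod 32) j ∈
        ({1, 3, 5, 7, 9, 11, 15, 19} : Finset (ZMod 32)) then (1 : ℚ) else 0 := by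
    intro i j
    show translateInd Φ.1 (τ i) (σ j) = _
    rw [translateInd_eq_ite₈, hτ, hσ, hΦ]
  have hli : LinearIndependent ℚ f := by
    rw [Fintype.linearIndependent_iff]
    intro g hg
    have heval : ∀ j : Fin 9, ∑ i, g i * f i (σ j) = 0 := fun j => by
      have := congrFun hg (σ j)
      simpa only [Finset.sum_apply, Pi.smul_apply, smul_eq_mul, Pi.zero_apply] using this
    have e0 := heval 0
    have e1 := heval 1
    have e2 := heval 2
    have e3 := heval 3
    have e4 := heval 4
    have e5 := heval 5
    have e6 := heval 6
    have e7 := heval 7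
    have e8 := heval 8
    simp (config := { decide := true }) [Fin.sum_univ_succ, hval] at e0 e1 e2 e3 e4 e5 e6 e7 e8
    intro i
    fin_cases i <;> simp <;> linarith
  have h1 : Module.finrank ℚ (Submodule.span ℚ (Set.range f)) = 9 := by
    rw [finrank_span_eq_card hli, Fintype.card_fin]
  have h2 : Submodule.span ℚ (Set.range f) ≤
      Submodule.span ℚ (Set.range fun g : ℂ ≃+* ℂ => translateInd Φ.1 g) :=
    Submodule.span_mono (by rintro _ ⟨i, rfl⟩; exact ⟨τ i, rfl⟩)
  have h3 := Submodule.finrank_mono h2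
  rw [h1] at h3
  exact h3

/-- **`Rank(Φ) ≥ 9` for the type with residue set `{1, 3, 5, 7, 9, 13, 15, 21}`** (`N3`): the translates by the automorphisms of `ℂ` with cyclotomic characters
`1, 3, 5, 7, 9, 11, 13, 15, 17`, read at the embeddings with exponents `1, 3, 5, 7, 9, 11, 13, 15, 17`, are linearly independent (the `9 × 9` minor of
`([u·c ∈ S])` has determinant `2`). [cite: Kubota1965, §2 (p. 115)] [cite: GreenGriffithsKerr2012, (V.A.7)–(V.A.8)] -/
private theorem nine_le_cmTypeRank_of_residueSet_eq_N3_thirtyTwo (Φ : CMType K) (hΦ : residueSet 32 Φ = {1, 3, 5, 7, 9, 13, 15, 21}) :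
    9 ≤ cmTypeRank Φ := by
  classical
  have hu : ∀ i : Fin 9, ((![1, 3, 5, 7, 9, 11, 13, 15, 17] : Fin 9 → ZMod 32) i).val.Coprime 32 := by decide
  have hc : ∀ j : Fin 9, ((![1, 3, 5, 7, 9, 11, 13, 15, 17] : Fin 9 → ZMod 32) j).val.Coprime 32 := by decide
  choose τ hτ using fun i : Fin 9 => exists_autExp_eq 32 _ (hu i)
  choose σ hσ using fun j : Fin 9 => exists_expOf_eq 32 K _ (hc j)
  let f : Fin 9 → (K →+* ℂ) → ℚ := fun i => translateInd Φ.1 (τ i)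
  have hval : ∀ i j : Fin 9, f i (σ j) =
      if (![1, 3, 5, 7, 9, 11, 13, 15, 17] : Fin 9 → ZMod 32) i * (![1, 3, 5, 7, 9, 11, 13, 15, 17] : Fin 9 → ZMod 32) j ∈
        ({1, 3, 5, 7, 9, 13, 15, 21} : Finset (ZMod 32)) then (1 : ℚ) else 0 := by
    intro i j
    show translateInd Φ.1 (τ i) (σ j) = _
    rw [translateInd_eq_ite₈, hτ, hσ, hΦ]
  have hli : LinearIndependent ℚ f := by
    rw [Fintype.linearIndependent_iff]
    intro g hg
    have heval : ∀ j : Fin 9, ∑ i, g i * f i (σ j) = 0 := fun j => by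
      have := congrFun hg (σ j)
      simpa only [Finset.sum_apply, Pi.smul_apply, smul_eq_mul, Pi.zero_apply] using this
    have e0 := heval 0
    have e1 := heval 1
    have e2 := heval 2
    have e3 := heval 3
    have e4 := heval 4
    have e5 := heval 5
    have e6 := heval 6
    have e7 := heval 7
    have e8 := heval 8
    simp (config := { decide := true }) [Fin.sum_univ_succ, hval] at e0 e1 e2 e3 e4 e5 e6 e7 e8
    intro i
    fin_cases i <;> simp <;> linarith
  have h1 : Module.finrank ℚ (Submodule.span ℚ (Set.range f)) = 9 := by
    rw [finrank_span_eq_card hli, Fintype.card_fin]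
  have h2 : Submodule.span ℚ (Set.range f) ≤
      Submodule.span ℚ (Set.range fun g : ℂ ≃+* ℂ => translateInd Φ.1 g) :=
    Submodule.span_mono (by rintro _ ⟨i, rfl⟩; exact ⟨τ i, rfl⟩)
  have h3 := Submodule.finrank_mono h2
  rw [h1] at h3
  exact h3

/-- **`Rank(Φ) ≥ 9` for the type with residue set `{1, 3, 5, 7, 9, 17, 19, 21}`** (`N4`): the translates by the automorphisms of `ℂ` with cyclotomic characters
`1, 3, 5, 7, 9, 11, 13, 15, 17`, read at the embeddings with exponents `1, 3, 5, 7, 9, 11, 13, 15, 17`, are linearly independent (the `9 × 9` minor of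
`([u·c ∈ S])` has determinant `-10`). [cite: Kubota1965, §2 (p. 115)] [cite: GreenGriffithsKerr2012, (V.A.7)–(V.A.8)] -/
private theorem nine_le_cmTypeRank_of_residueSet_eq_N4_thirtyTwo (Φ : CMType K) (hΦ : residueSet 32 Φ = {1, 3, 5, 7, 9, 17, 19, 21}) :
    9 ≤ cmTypeRank Φ := by
  classical
  have hu : ∀ i : Fin 9, ((![1, 3, 5, 7, 9, 11, 13, 15, 17] : Fin 9 → ZMod 32) i).val.Coprime 32 := by decide
  have hc : ∀ j : Fin 9, ((![1, 3, 5, 7, 9, 11, 13, 15, 17] : Fin 9 → ZMod 32) j).val.Coprime 32 := by decide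
  choose τ hτ using fun i : Fin 9 => exists_autExp_eq 32 _ (hu i)
  choose σ hσ using fun j : Fin 9 => exists_expOf_eq 32 K _ (hc j)
  let f : Fin 9 → (K →+* ℂ) → ℚ := fun i => translateInd Φ.1 (τ i)
  have hval : ∀ i j : Fin 9, f i (σ j) =
      if (![1, 3, 5, 7, 9, 11, 13, 15, 17] : Fin 9 → ZMod 32) i * (![1, 3, 5, 7, 9, 11, 13, 15, 17] : Fin 9 → ZMod 32) j ∈
        ({1, 3, 5, 7, 9, 17, 19, 21} : Finset (ZMod 32)) then (1 : ℚ) else 0 := by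
    intro i j
    show translateInd Φ.1 (τ i) (σ j) = _
    rw [translateInd_eq_ite₈, hτ, hσ, hΦ]
  have hli : LinearIndependent ℚ f := by
    rw [Fintype.linearIndependent_iff]
    intro g hg
    have heval : ∀ j : Fin 9, ∑ i, g i * f i (σ j) = 0 := fun j => by
      have := congrFun hg (σ j)
      simpa only [Finset.sum_apply, Pi.smul_apply, smul_eq_mul, Pi.zero_apply] using this
    have e0 := heval 0
    have e1 := heval 1
    have e2 := heval 2
    have e3 := heval 3
    have e4 := heval 4
    have e5 := heval 5
    have e6 := heval 6
    have e7 := heval 7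
    have e8 := heval 8
    simp (config := { decide := true }) [Fin.sum_univ_succ, hval] at e0 e1 e2 e3 e4 e5 e6 e7 e8
    intro i
    fin_cases i <;> simp <;> linarith
  have h1 : Module.finrank ℚ (Submodule.span ℚ (Set.range f)) = 9 := by
    rw [finrank_span_eq_card hli, Fintype.card_fin]
  have h2 : Submodule.span ℚ (Set.range f) ≤
      Submodule.span ℚ (Set.range fun g : ℂ ≃+* ℂ => translateInd Φ.1 g) :=
    Submodule.span_mono (by rintro _ ⟨i, rfl⟩; exact ⟨τ i, rfl⟩)
  have h3 := Submodule.finrank_mono h2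
  rw [h1] at h3
  exact h3

/-- **`Rank(Φ) ≥ 9` for the type with residue set `{1, 3, 5, 7, 11, 17, 19, 23}`** (`N5`): the translates by the automorphisms of `ℂ` with cyclotomic characters
`1, 3, 5, 7, 9, 11, 13, 15, 17`, read at the embeddings with exponents `1, 3, 5, 7, 9, 11, 13, 15, 17`, are linearly independent (the `9 × 9` minor of
`([u·c ∈ S])` has determinant `10`). [cite: Kubota1965, §2 (p. 115)] [cite: GreenGriffithsKerr2012, (V.A.7)–(V.A.8)] -/
private theorem nine_le_cmTypeRank_of_residueSet_eq_N5_thirtyTwo (Φ : CMType K) (hΦ : residueSet 32 Φ = {1, 3, 5, 7, 11, 17, 19, 23}) :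
    9 ≤ cmTypeRank Φ := by
  classical
  have hu : ∀ i : Fin 9, ((![1, 3, 5, 7, 9, 11, 13, 15, 17] : Fin 9 → ZMod 32) i).val.Coprime 32 := by decide
  have hc : ∀ j : Fin 9, ((![1, 3, 5, 7, 9, 11, 13, 15, 17] : Fin 9 → ZMod 32) j).val.Coprime 32 := by decide
  choose τ hτ using fun i : Fin 9 => exists_autExp_eq 32 _ (hu i)
  choose σ hσ using fun j : Fin 9 => exists_expOf_eq 32 K _ (hc j)
  let f : Fin 9 → (K →+* ℂ) → ℚ := fun i => translateInd Φ.1 (τ i)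
  have hval : ∀ i j : Fin 9, f i (σ j) =
      if (![1, 3, 5, 7, 9, 11, 13, 15, 17] : Fin 9 → ZMod 32) i * (![1, 3, 5, 7, 9, 11, 13, 15, 17] : Fin 9 → ZMod 32) j ∈
        ({1, 3, 5, 7, 11, 17, 19, 23} : Finset (ZMod 32)) then (1 : ℚ) else 0 := by
    intro i j
    show translateInd Φ.1 (τ i) (σ j) = _
    rw [translateInd_eq_ite₈, hτ, hσ, hΦ]
  have hli : LinearIndependent ℚ f := by
    rw [Fintype.linearIndependent_iff]
    intro g hg
    have heval : ∀ j : Fin 9, ∑ i, g i * f i (σ j) = 0 := fun j => by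
      have := congrFun hg (σ j)
      simpa only [Finset.sum_apply, Pi.smul_apply, smul_eq_mul, Pi.zero_apply] using this
    have e0 := heval 0
    have e1 := heval 1
    have e2 := heval 2
    have e3 := heval 3
    have e4 := heval 4
    have e5 := heval 5
    have e6 := heval 6
    have e7 := heval 7
    have e8 := heval 8
    simp (config := { decide := true }) [Fin.sum_univ_succ, hval] at e0 e1 e2 e3 e4 e5 e6 e7 e8
    intro i
    fin_cases i <;> simp <;> linarith
  have h1 : Module.finrank ℚ (Submodule.span ℚ (Set.range f)) = 9 := by
    rw [finrank_span_eq_card hli, Fintype.card_fin]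
  have h2 : Submodule.span ℚ (Set.range f) ≤
      Submodule.span ℚ (Set.range fun g : ℂ ≃+* ℂ => translateInd Φ.1 g) :=
    Submodule.span_mono (by rintro _ ⟨i, rfl⟩; exact ⟨τ i, rfl⟩)
  have h3 := Submodule.finrank_mono h2
  rw [h1] at h3
  exact h3

/-- **`Rank(Φ) ≥ 9` for the type with residue set `{1, 3, 5, 9, 11, 17, 19, 25}`** (`N6`): the translates by the automorphisms of `ℂ` with cyclotomic characters
`1, 3, 5, 7, 9, 11, 13, 15, 17`, read at the embeddings with exponents `1, 3, 5, 7, 9, 11, 13, 15, 17`, are linearly independent (the `9 × 9` minor of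
`([u·c ∈ S])` has determinant `-6`). [cite: Kubota1965, §2 (p. 115)] [cite: GreenGriffithsKerr2012, (V.A.7)–(V.A.8)] -/
private theorem nine_le_cmTypeRank_of_residueSet_eq_N6_thirtyTwo (Φ : CMType K) (hΦ : residueSet 32 Φ = {1, 3, 5, 9, 11, 17, 19, 25}) :
    9 ≤ cmTypeRank Φ := by
  classical
  have hu : ∀ i : Fin 9, ((![1, 3, 5, 7, 9, 11, 13, 15, 17] : Fin 9 → ZMod 32) i).val.Coprime 32 := by decide
  have hc : ∀ j : Fin 9, ((![1, 3, 5, 7, 9, 11, 13, 15, 17] : Fin 9 → ZMod 32) j).val.Coprime 32 := by decide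
  choose τ hτ using fun i : Fin 9 => exists_autExp_eq 32 _ (hu i)
  choose σ hσ using fun j : Fin 9 => exists_expOf_eq 32 K _ (hc j)
  let f : Fin 9 → (K →+* ℂ) → ℚ := fun i => translateInd Φ.1 (τ i)
  have hval : ∀ i j : Fin 9, f i (σ j) =
      if (![1, 3, 5, 7, 9, 11, 13, 15, 17] : Fin 9 → ZMod 32) i * (![1, 3, 5, 7, 9, 11, 13, 15, 17] : Fin 9 → ZMod 32) j ∈
        ({1, 3, 5, 9, 11, 17, 19, 25} : Finset (ZMod 32)) then (1 : ℚ) else 0 := by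
    intro i j
    show translateInd Φ.1 (τ i) (σ j) = _
    rw [translateInd_eq_ite₈, hτ, hσ, hΦ]
  have hli : LinearIndependent ℚ f := by
    rw [Fintype.linearIndependent_iff]
    intro g hg
    have heval : ∀ j : Fin 9, ∑ i, g i * f i (σ j) = 0 := fun j => by
      have := congrFun hg (σ j)
      simpa only [Finset.sum_apply, Pi.smul_apply, smul_eq_mul, Pi.zero_apply] using this
    have e0 := heval 0
    have e1 := heval 1
    have e2 := heval 2
    have e3 := heval 3
    have e4 := heval 4
    have e5 := heval 5
    have e6 := heval 6
    have e7 := heval 7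
    have e8 := heval 8
    simp (config := { decide := true }) [Fin.sum_univ_succ, hval] at e0 e1 e2 e3 e4 e5 e6 e7 e8
    intro i
    fin_cases i <;> simp <;> linarith
  have h1 : Module.finrank ℚ (Submodule.span ℚ (Set.range f)) = 9 := by
    rw [finrank_span_eq_card hli, Fintype.card_fin]
  have h2 : Submodule.span ℚ (Set.range f) ≤
      Submodule.span ℚ (Set.range fun g : ℂ ≃+* ℂ => translateInd Φ.1 g) :=
    Submodule.span_mono (by rintro _ ⟨i, rfl⟩; exact ⟨τ i, rfl⟩)
  have h3 := Submodule.finrank_mono h2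
  rw [h1] at h3
  exact h3

/-- **`Rank(Φ) ≥ 9` for the type with residue set `{1, 3, 5, 9, 13, 17, 21, 25}`** (`N7`): the translates by the automorphisms of `ℂ` with cyclotomic characters
`1, 3, 5, 7, 9, 11, 13, 15, 17`, read at the embeddings with exponents `1, 3, 5, 7, 9, 11, 13, 15, 17`, are linearly independent (the `9 × 9` minor of
`([u·c ∈ S])` has determinant `-6`). [cite: Kubota1965, §2 (p. 115)] [cite: GreenGriffithsKerr2012, (V.A.7)–(V.A.8)] -/
private theorem nine_le_cmTypeRank_of_residueSet_eq_N7_thirtyTwo (Φ : CMType K) (hΦ : residueSet 32 Φ = {1, 3, 5, 9, 13, 17, 21, 25}) :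
    9 ≤ cmTypeRank Φ := by
  classical
  have hu : ∀ i : Fin 9, ((![1, 3, 5, 7, 9, 11, 13, 15, 17] : Fin 9 → ZMod 32) i).val.Coprime 32 := by decide
  have hc : ∀ j : Fin 9, ((![1, 3, 5, 7, 9, 11, 13, 15, 17] : Fin 9 → ZMod 32) j).val.Coprime 32 := by decide
  choose τ hτ using fun i : Fin 9 => exists_autExp_eq 32 _ (hu i)
  choose σ hσ using fun j : Fin 9 => exists_expOf_eq 32 K _ (hc j)
  let f : Fin 9 → (K →+* ℂ) → ℚ := fun i => translateInd Φ.1 (τ i)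
  have hval : ∀ i j : Fin 9, f i (σ j) =
      if (![1, 3, 5, 7, 9, 11, 13, 15, 17] : Fin 9 → ZMod 32) i * (![1, 3, 5, 7, 9, 11, 13, 15, 17] : Fin 9 → ZMod 32) j ∈
        ({1, 3, 5, 9, 13, 17, 21, 25} : Finset (ZMod 32)) then (1 : ℚ) else 0 := by
    intro i j
    show translateInd Φ.1 (τ i) (σ j) = _
    rw [translateInd_eq_ite₈, hτ, hσ, hΦ]
  have hli : LinearIndependent ℚ f := by
    rw [Fintype.linearIndependent_iff]
    intro g hg
    have heval : ∀ j : Fin 9, ∑ i, g i * f i (σ j) = 0 := fun j => by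
      have := congrFun hg (σ j)
      simpa only [Finset.sum_apply, Pi.smul_apply, smul_eq_mul, Pi.zero_apply] using this
    have e0 := heval 0
    have e1 := heval 1
    have e2 := heval 2
    have e3 := heval 3
    have e4 := heval 4
    have e5 := heval 5
    have e6 := heval 6
    have e7 := heval 7
    have e8 := heval 8
    simp (config := { decide := true }) [Fin.sum_univ_succ, hval] at e0 e1 e2 e3 e4 e5 e6 e7 e8
    intro i
    fin_cases i <;> simp <;> linarith
  have h1 : Module.finrank ℚ (Submodule.span ℚ (Set.range f)) = 9 := by
    rw [finrank_span_eq_card hli, Fintype.card_fin]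
  have h2 : Submodule.span ℚ (Set.range f) ≤
      Submodule.span ℚ (Set.range fun g : ℂ ≃+* ℂ => translateInd Φ.1 g) :=
    Submodule.span_mono (by rintro _ ⟨i, rfl⟩; exact ⟨τ i, rfl⟩)
  have h3 := Submodule.finrank_mono h2
  rw [h1] at h3
  exact h3

/-- **`Rank(Φ) ≥ 9` for the type with residue set `{1, 3, 13, 17, 21, 23, 25, 27}`** (`N8`): the translates by the automorphisms of `ℂ` with cyclotomic characters
`1, 3, 5, 7, 9, 11, 13, 15, 17`, read at the embeddings with exponents `1, 3, 5, 7, 9, 11, 13, 15, 17`, are linearly independent (the `9 × 9` minor of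
`([u·c ∈ S])` has determinant `-2`). [cite: Kubota1965, §2 (p. 115)] [cite: GreenGriffithsKerr2012, (V.A.7)–(V.A.8)] -/
private theorem nine_le_cmTypeRank_of_residueSet_eq_N8_thirtyTwo (Φ : CMType K) (hΦ : residueSet 32 Φ = {1, 3, 13, 17, 21, 23, 25, 27}) :
    9 ≤ cmTypeRank Φ := by
  classical
  have hu : ∀ i : Fin 9, ((![1, 3, 5, 7, 9, 11, 13, 15, 17] : Fin 9 → ZMod 32) i).val.Coprime 32 := by decide
  have hc : ∀ j : Fin 9, ((![1, 3, 5, 7, 9, 11, 13, 15, 17] : Fin 9 → ZMod 32) j).val.Coprime 32 := by decide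
  choose τ hτ using fun i : Fin 9 => exists_autExp_eq 32 _ (hu i)
  choose σ hσ using fun j : Fin 9 => exists_expOf_eq 32 K _ (hc j)
  let f : Fin 9 → (K →+* ℂ) → ℚ := fun i => translateInd Φ.1 (τ i)
  have hval : ∀ i j : Fin 9, f i (σ j) =
      if (![1, 3, 5, 7, 9, 11, 13, 15, 17] : Fin 9 → ZMod 32) i * (![1, 3, 5, 7, 9, 11, 13, 15, 17] : Fin 9 → ZMod 32) j ∈
        ({1, 3, 13, 17, 21, 23, 25, 27} : Finset (ZMod 32)) then (1 : ℚ) else 0 := by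
    intro i j
    show translateInd Φ.1 (τ i) (σ j) = _
    rw [translateInd_eq_ite₈, hτ, hσ, hΦ]
  have hli : LinearIndependent ℚ f := by
    rw [Fintype.linearIndependent_iff]
    intro g hg
    have heval : ∀ j : Fin 9, ∑ i, g i * f i (σ j) = 0 := fun j => by
      have := congrFun hg (σ j)
      simpa only [Finset.sum_apply, Pi.smul_apply, smul_eq_mul, Pi.zero_apply] using this
    have e0 := heval 0
    have e1 := heval 1
    have e2 := heval 2
    have e3 := heval 3
    have e4 := heval 4
    have e5 := heval 5
    have e6 := heval 6
    have e7 := heval 7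
    have e8 := heval 8
    simp (config := { decide := true }) [Fin.sum_univ_succ, hval] at e0 e1 e2 e3 e4 e5 e6 e7 e8
    intro i
    fin_cases i <;> simp <;> linarith
  have h1 : Module.finrank ℚ (Submodule.span ℚ (Set.range f)) = 9 := by
    rw [finrank_span_eq_card hli, Fintype.card_fin]
  have h2 : Submodule.span ℚ (Set.range f) ≤
      Submodule.span ℚ (Set.range fun g : ℂ ≃+* ℂ => translateInd Φ.1 g) :=
    Submodule.span_mono (by rintro _ ⟨i, rfl⟩; exact ⟨τ i, rfl⟩)
  have h3 := Submodule.finrank_mono h2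
  rw [h1] at h3
  exact h3

/-- **`Rank(Φ) ≥ 8` for the type with residue set `{1, 3, 5, 7, 9, 13, 17, 21}`** (`D1`): the translates by the automorphisms of `ℂ` with cyclotomic characters
`1, 3, 5, 7, 9, 11, 13, 17`, read at the embeddings with exponents `1, 3, 5, 7, 9, 11, 13, 17`, are linearly independent (the `8 × 8` minor of
`([u·c ∈ S])` has determinant `-2`). [cite: Kubota1965, §2 (p. 115)] [cite: GreenGriffithsKerr2012, (V.A.7)–(V.A.8)] -/
private theorem eight_le_cmTypeRank_of_residueSet_eq_D1_thirtyTwo (Φ : CMType K) (hΦ : residueSet 32 Φ = {1, 3, 5, 7, 9, 13, 17, 21}) :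
    8 ≤ cmTypeRank Φ := by
  classical
  have hu : ∀ i : Fin 8, ((![1, 3, 5, 7, 9, 11, 13, 17] : Fin 8 → ZMod 32) i).val.Coprime 32 := by decide
  have hc : ∀ j : Fin 8, ((![1, 3, 5, 7, 9, 11, 13, 17] : Fin 8 → ZMod 32) j).val.Coprime 32 := by decide
  choose τ hτ using fun i : Fin 8 => exists_autExp_eq 32 _ (hu i)
  choose σ hσ using fun j : Fin 8 => exists_expOf_eq 32 K _ (hc j)
  let f : Fin 8 → (K →+* ℂ) → ℚ := fun i => translateInd Φ.1 (τ i)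
  have hval : ∀ i j : Fin 8, f i (σ j) =
      if (![1, 3, 5, 7, 9, 11, 13, 17] : Fin 8 → ZMod 32) i * (![1, 3, 5, 7, 9, 11, 13, 17] : Fin 8 → ZMod 32) j ∈
        ({1, 3, 5, 7, 9, 13, 17, 21} : Finset (ZMod 32)) then (1 : ℚ) else 0 := by
    intro i j
    show translateInd Φ.1 (τ i) (σ j) = _
    rw [translateInd_eq_ite₈, hτ, hσ, hΦ]
  have hli : LinearIndependent ℚ f := by
    rw [Fintype.linearIndependent_iff]
    intro g hg
    have heval : ∀ j : Fin 8, ∑ i, g i * f i (σ j) = 0 := fun j => by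
      have := congrFun hg (σ j)
      simpa only [Finset.sum_apply, Pi.smul_apply, smul_eq_mul, Pi.zero_apply] using this
    have e0 := heval 0
    have e1 := heval 1
    have e2 := heval 2
    have e3 := heval 3
    have e4 := heval 4
    have e5 := heval 5
    have e6 := heval 6
    have e7 := heval 7
    simp (config := { decide := true }) [Fin.sum_univ_succ, hval] at e0 e1 e2 e3 e4 e5 e6 e7
    intro i
    fin_cases i <;> simp <;> linarith
  have h1 : Module.finrank ℚ (Submodule.span ℚ (Set.range f)) = 8 := by
    rw [finrank_span_eq_card hli, Fintype.card_fin]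
  have h2 : Submodule.span ℚ (Set.range f) ≤
      Submodule.span ℚ (Set.range fun g : ℂ ≃+* ℂ => translateInd Φ.1 g) :=
    Submodule.span_mono (by rintro _ ⟨i, rfl⟩; exact ⟨τ i, rfl⟩)
  have h3 := Submodule.finrank_mono h2
  rw [h1] at h3
  exact h3

/-- **`Rank(Φ) ≥ 8` for the type with residue set `{1, 3, 5, 7, 13, 15, 21, 23}`** (`D2`): the translates by the automorphisms of `ℂ` with cyclotomic characters
`1, 3, 5, 7, 9, 11, 13, 17`, read at the embeddings with exponents `1, 3, 5, 7, 9, 11, 13, 17`, are linearly independent (the `8 × 8` minor of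
`([u·c ∈ S])` has determinant `2`). [cite: Kubota1965, §2 (p. 115)] [cite: GreenGriffithsKerr2012, (V.A.7)–(V.A.8)] -/
private theorem eight_le_cmTypeRank_of_residueSet_eq_D2_thirtyTwo (Φ : CMType K) (hΦ : residueSet 32 Φ = {1, 3, 5, 7, 13, 15, 21, 23}) :
    8 ≤ cmTypeRank Φ := by
  classical
  have hu : ∀ i : Fin 8, ((![1, 3, 5, 7, 9, 11, 13, 17] : Fin 8 → ZMod 32) i).val.Coprime 32 := by decide
  have hc : ∀ j : Fin 8, ((![1, 3, 5, 7, 9, 11, 13, 17] : Fin 8 → ZMod 32) j).val.Coprime 32 := by decide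
  choose τ hτ using fun i : Fin 8 => exists_autExp_eq 32 _ (hu i)
  choose σ hσ using fun j : Fin 8 => exists_expOf_eq 32 K _ (hc j)
  let f : Fin 8 → (K →+* ℂ) → ℚ := fun i => translateInd Φ.1 (τ i)
  have hval : ∀ i j : Fin 8, f i (σ j) =
      if (![1, 3, 5, 7, 9, 11, 13, 17] : Fin 8 → ZMod 32) i * (![1, 3, 5, 7, 9, 11, 13, 17] : Fin 8 → ZMod 32) j ∈
        ({1, 3, 5, 7, 13, 15, 21, 23} : Finset (ZMod 32)) then (1 : ℚ) else 0 := by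
    intro i j
    show translateInd Φ.1 (τ i) (σ j) = _
    rw [translateInd_eq_ite₈, hτ, hσ, hΦ]
  have hli : LinearIndependent ℚ f := by
    rw [Fintype.linearIndependent_iff]
    intro g hg
    have heval : ∀ j : Fin 8, ∑ i, g i * f i (σ j) = 0 := fun j => by
      have := congrFun hg (σ j)
      simpa only [Finset.sum_apply, Pi.smul_apply, smul_eq_mul, Pi.zero_apply] using this
    have e0 := heval 0
    have e1 := heval 1
    have e2 := heval 2
    have e3 := heval 3
    have e4 := heval 4
    have e5 := heval 5
    have e6 := heval 6
    have e7 := heval 7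
    simp (config := { decide := true }) [Fin.sum_univ_succ, hval] at e0 e1 e2 e3 e4 e5 e6 e7
    intro i
    fin_cases i <;> simp <;> linarith
  have h1 : Module.finrank ℚ (Submodule.span ℚ (Set.range f)) = 8 := by
    rw [finrank_span_eq_card hli, Fintype.card_fin]
  have h2 : Submodule.span ℚ (Set.range f) ≤
      Submodule.span ℚ (Set.range fun g : ℂ ≃+* ℂ => translateInd Φ.1 g) :=
    Submodule.span_mono (by rintro _ ⟨i, rfl⟩; exact ⟨τ i, rfl⟩)
  have h3 := Submodule.finrank_mono h2
  rw [h1] at h3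
  exact h3

/-- **`Rank(Φ) ≥ 8` for the type with residue set `{1, 3, 5, 13, 17, 21, 23, 25}`** (`D3`): the translates by the automorphisms of `ℂ` with cyclotomic characters
`1, 3, 5, 7, 9, 11, 13, 17`, read at the embeddings with exponents `1, 3, 5, 7, 9, 11, 13, 17`, are linearly independent (the `8 × 8` minor of
`([u·c ∈ S])` has determinant `-2`). [cite: Kubota1965, §2 (p. 115)] [cite: GreenGriffithsKerr2012, (V.A.7)–(V.A.8)] -/
private theorem eight_le_cmTypeRank_of_residueSet_eq_D3_thirtyTwo (Φ : CMType K) (hΦ : residueSet 32 Φ = {1, 3, 5, 13, 17, 21, 23, 25}) :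
    8 ≤ cmTypeRank Φ := by
  classical
  have hu : ∀ i : Fin 8, ((![1, 3, 5, 7, 9, 11, 13, 17] : Fin 8 → ZMod 32) i).val.Coprime 32 := by decide
  have hc : ∀ j : Fin 8, ((![1, 3, 5, 7, 9, 11, 13, 17] : Fin 8 → ZMod 32) j).val.Coprime 32 := by decide
  choose τ hτ using fun i : Fin 8 => exists_autExp_eq 32 _ (hu i)
  choose σ hσ using fun j : Fin 8 => exists_expOf_eq 32 K _ (hc j)
  let f : Fin 8 → (K →+* ℂ) → ℚ := fun i => translateInd Φ.1 (τ i)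
  have hval : ∀ i j : Fin 8, f i (σ j) =
      if (![1, 3, 5, 7, 9, 11, 13, 17] : Fin 8 → ZMod 32) i * (![1, 3, 5, 7, 9, 11, 13, 17] : Fin 8 → ZMod 32) j ∈
        ({1, 3, 5, 13, 17, 21, 23, 25} : Finset (ZMod 32)) then (1 : ℚ) else 0 := by
    intro i j
    show translateInd Φ.1 (τ i) (σ j) = _
    rw [translateInd_eq_ite₈, hτ, hσ, hΦ]
  have hli : LinearIndependent ℚ f := by
    rw [Fintype.linearIndependent_iff]
    intro g hg
    have heval : ∀ j : Fin 8, ∑ i, g i * f i (σ j) = 0 := fun j => by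
      have := congrFun hg (σ j)
      simpa only [Finset.sum_apply, Pi.smul_apply, smul_eq_mul, Pi.zero_apply] using this
    have e0 := heval 0
    have e1 := heval 1
    have e2 := heval 2
    have e3 := heval 3
    have e4 := heval 4
    have e5 := heval 5
    have e6 := heval 6
    have e7 := heval 7
    simp (config := { decide := true }) [Fin.sum_univ_succ, hval] at e0 e1 e2 e3 e4 e5 e6 e7
    intro i
    fin_cases i <;> simp <;> linarith
  have h1 : Module.finrank ℚ (Submodule.span ℚ (Set.range f)) = 8 := by
    rw [finrank_span_eq_card hli, Fintype.card_fin]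
  have h2 : Submodule.span ℚ (Set.range f) ≤
      Submodule.span ℚ (Set.range fun g : ℂ ≃+* ℂ => translateInd Φ.1 g) :=
    Submodule.span_mono (by rintro _ ⟨i, rfl⟩; exact ⟨τ i, rfl⟩)
  have h3 := Submodule.finrank_mono h2
  rw [h1] at h3
  exact h3

/-- **`Rank(Φ) ≥ 8` for the type with residue set `{1, 7, 13, 15, 21, 23, 27, 29}`** (`D4`): the translates by the automorphisms of `ℂ` with cyclotomic characters
`1, 3, 5, 7, 9, 11, 13, 17`, read at the embeddings with exponents `1, 3, 5, 7, 9, 11, 13, 17`, are linearly independent (the `8 × 8` minor of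
`([u·c ∈ S])` has determinant `2`). [cite: Kubota1965, §2 (p. 115)] [cite: GreenGriffithsKerr2012, (V.A.7)–(V.A.8)] -/
private theorem eight_le_cmTypeRank_of_residueSet_eq_D4_thirtyTwo (Φ : CMType K) (hΦ : residueSet 32 Φ = {1, 7, 13, 15, 21, 23, 27, 29}) :
    8 ≤ cmTypeRank Φ := by
  classical
  have hu : ∀ i : Fin 8, ((![1, 3, 5, 7, 9, 11, 13, 17] : Fin 8 → ZMod 32) i).val.Coprime 32 := by decide
  have hc : ∀ j : Fin 8, ((![1, 3, 5, 7, 9, 11, 13, 17] : Fin 8 → ZMod 32) j).val.Coprime 32 := by decide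
  choose τ hτ using fun i : Fin 8 => exists_autExp_eq 32 _ (hu i)
  choose σ hσ using fun j : Fin 8 => exists_expOf_eq 32 K _ (hc j)
  let f : Fin 8 → (K →+* ℂ) → ℚ := fun i => translateInd Φ.1 (τ i)
  have hval : ∀ i j : Fin 8, f i (σ j) =
      if (![1, 3, 5, 7, 9, 11, 13, 17] : Fin 8 → ZMod 32) i * (![1, 3, 5, 7, 9, 11, 13, 17] : Fin 8 → ZMod 32) j ∈
        ({1, 7, 13, 15, 21, 23, 27, 29} : Finset (ZMod 32)) then (1 : ℚ) else 0 := by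
    intro i j
    show translateInd Φ.1 (τ i) (σ j) = _
    rw [translateInd_eq_ite₈, hτ, hσ, hΦ]
  have hli : LinearIndependent ℚ f := by
    rw [Fintype.linearIndependent_iff]
    intro g hg
    have heval : ∀ j : Fin 8, ∑ i, g i * f i (σ j) = 0 := fun j => by
      have := congrFun hg (σ j)
      simpa only [Finset.sum_apply, Pi.smul_apply, smul_eq_mul, Pi.zero_apply] using this
    have e0 := heval 0
    have e1 := heval 1
    have e2 := heval 2
    have e3 := heval 3
    have e4 := heval 4
    have e5 := heval 5
    have e6 := heval 6
    have e7 := heval 7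
    simp (config := { decide := true }) [Fin.sum_univ_succ, hval] at e0 e1 e2 e3 e4 e5 e6 e7
    intro i
    fin_cases i <;> simp <;> linarith
  have h1 : Module.finrank ℚ (Submodule.span ℚ (Set.range f)) = 8 := by
    rw [finrank_span_eq_card hli, Fintype.card_fin]
  have h2 : Submodule.span ℚ (Set.range f) ≤
      Submodule.span ℚ (Set.range fun g : ℂ ≃+* ℂ => translateInd Φ.1 g) :=
    Submodule.span_mono (by rintro _ ⟨i, rfl⟩; exact ⟨τ i, rfl⟩)
  have h3 := Submodule.finrank_mono h2
  rw [h1] at h3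
  exact h3

/-- **`Rank(Φ) ≥ 7` for the type with residue set `{1, 3, 5, 9, 11, 13, 17, 25}`** (`D5`): the translates by the automorphisms of `ℂ` with cyclotomic characters
`1, 3, 5, 7, 9, 11, 17`, read at the embeddings with exponents `1, 3, 5, 7, 9, 11, 17`, are linearly independent (the `7 × 7` minor of
`([u·c ∈ S])` has determinant `2`). [cite: Kubota1965, §2 (p. 115)] [cite: GreenGriffithsKerr2012, (V.A.7)–(V.A.8)] -/
private theorem seven_le_cmTypeRank_of_residueSet_eq_D5_thirtyTwo (Φ : CMType K) (hΦ : residueSet 32 Φ = {1, 3, 5, 9, 11, 13, 17, 25}) :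
    7 ≤ cmTypeRank Φ := by
  classical
  have hu : ∀ i : Fin 7, ((![1, 3, 5, 7, 9, 11, 17] : Fin 7 → ZMod 32) i).val.Coprime 32 := by decide
  have hc : ∀ j : Fin 7, ((![1, 3, 5, 7, 9, 11, 17] : Fin 7 → ZMod 32) j).val.Coprime 32 := by decide
  choose τ hτ using fun i : Fin 7 => exists_autExp_eq 32 _ (hu i)
  choose σ hσ using fun j : Fin 7 => exists_expOf_eq 32 K _ (hc j)
  let f : Fin 7 → (K →+* ℂ) → ℚ := fun i => translateInd Φ.1 (τ i)
  have hval : ∀ i j : Fin 7, f i (σ j) =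
      if (![1, 3, 5, 7, 9, 11, 17] : Fin 7 → ZMod 32) i * (![1, 3, 5, 7, 9, 11, 17] : Fin 7 → ZMod 32) j ∈
        ({1, 3, 5, 9, 11, 13, 17, 25} : Finset (ZMod 32)) then (1 : ℚ) else 0 := by
    intro i j
    show translateInd Φ.1 (τ i) (σ j) = _
    rw [translateInd_eq_ite₈, hτ, hσ, hΦ]
  have hli : LinearIndependent ℚ f := by
    rw [Fintype.linearIndependent_iff]
    intro g hg
    have heval : ∀ j : Fin 7, ∑ i, g i * f i (σ j) = 0 := fun j => by
      have := congrFun hg (σ j)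
      simpa only [Finset.sum_apply, Pi.smul_apply, smul_eq_mul, Pi.zero_apply] using this
    have e0 := heval 0
    have e1 := heval 1
    have e2 := heval 2
    have e3 := heval 3
    have e4 := heval 4
    have e5 := heval 5
    have e6 := heval 6
    simp (config := { decide := true }) [Fin.sum_univ_succ, hval] at e0 e1 e2 e3 e4 e5 e6
    intro i
    fin_cases i <;> simp <;> linarith
  have h1 : Module.finrank ℚ (Submodule.span ℚ (Set.range f)) = 7 := by
    rw [finrank_span_eq_card hli, Fintype.card_fin]
  have h2 : Submodule.span ℚ (Set.range f) ≤
      Submodule.span ℚ (Set.range fun g : ℂ ≃+* ℂ => translateInd Φ.1 g) :=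
    Submodule.span_mono (by rintro _ ⟨i, rfl⟩; exact ⟨τ i, rfl⟩)
  have h3 := Submodule.finrank_mono h2
  rw [h1] at h3
  exact h3

/-- **`Rank(Φ) ≥ 7` for the type with residue set `{1, 7, 9, 11, 13, 15, 27, 29}`** (`D6`): the translates by the automorphisms of `ℂ` with cyclotomic characters
`1, 3, 5, 7, 9, 11, 17`, read at the embeddings with exponents `1, 3, 5, 7, 9, 11, 17`, are linearly independent (the `7 × 7` minor of
`([u·c ∈ S])` has determinant `-2`). [cite: Kubota1965, §2 (p. 115)] [cite: GreenGriffithsKerr2012, (V.A.7)–(V.A.8)] -/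
private theorem seven_le_cmTypeRank_of_residueSet_eq_D6_thirtyTwo (Φ : CMType K) (hΦ : residueSet 32 Φ = {1, 7, 9, 11, 13, 15, 27, 29}) :
    7 ≤ cmTypeRank Φ := by
  classical
  have hu : ∀ i : Fin 7, ((![1, 3, 5, 7, 9, 11, 17] : Fin 7 → ZMod 32) i).val.Coprime 32 := by decide
  have hc : ∀ j : Fin 7, ((![1, 3, 5, 7, 9, 11, 17] : Fin 7 → ZMod 32) j).val.Coprime 32 := by decide
  choose τ hτ using fun i : Fin 7 => exists_autExp_eq 32 _ (hu i)
  choose σ hσ using fun j : Fin 7 => exists_expOf_eq 32 K _ (hc j)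
  let f : Fin 7 → (K →+* ℂ) → ℚ := fun i => translateInd Φ.1 (τ i)
  have hval : ∀ i j : Fin 7, f i (σ j) =
      if (![1, 3, 5, 7, 9, 11, 17] : Fin 7 → ZMod 32) i * (![1, 3, 5, 7, 9, 11, 17] : Fin 7 → ZMod 32) j ∈
        ({1, 7, 9, 11, 13, 15, 27, 29} : Finset (ZMod 32)) then (1 : ℚ) else 0 := by
    intro i j
    show translateInd Φ.1 (τ i) (σ j) = _
    rw [translateInd_eq_ite₈, hτ, hσ, hΦ]
  have hli : LinearIndependent ℚ f := by
    rw [Fintype.linearIndependent_iff]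
    intro g hg
    have heval : ∀ j : Fin 7, ∑ i, g i * f i (σ j) = 0 := fun j => by
      have := congrFun hg (σ j)
      simpa only [Finset.sum_apply, Pi.smul_apply, smul_eq_mul, Pi.zero_apply] using this
    have e0 := heval 0
    have e1 := heval 1
    have e2 := heval 2
    have e3 := heval 3
    have e4 := heval 4
    have e5 := heval 5
    have e6 := heval 6
    simp (config := { decide := true }) [Fin.sum_univ_succ, hval] at e0 e1 e2 e3 e4 e5 e6
    intro i
    fin_cases i <;> simp <;> linarith
  have h1 : Module.finrank ℚ (Submodule.span ℚ (Set.range f)) = 7 := by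
    rw [finrank_span_eq_card hli, Fintype.card_fin]
  have h2 : Submodule.span ℚ (Set.range f) ≤
      Submodule.span ℚ (Set.range fun g : ℂ ≃+* ℂ => translateInd Φ.1 g) :=
    Submodule.span_mono (by rintro _ ⟨i, rfl⟩; exact ⟨τ i, rfl⟩)
  have h3 := Submodule.finrank_mono h2
  rw [h1] at h3
  exact h3

/-- **`Rank(Φ) ≥ 5` for the type with residue set `{1, 3, 5, 7, 9, 11, 13, 15}`** (`I1`): the translates by the automorphisms of `ℂ` with cyclotomic characters
`1, 3, 5, 7, 17`, read at the embeddings with exponents `1, 3, 5, 7, 17`, are linearly independent (the `5 × 5` minor of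
`([u·c ∈ S])` has determinant `1`). [cite: Kubota1965, §2 (p. 115)] [cite: GreenGriffithsKerr2012, (V.A.7)–(V.A.8)] -/
private theorem five_le_cmTypeRank_of_residueSet_eq_I1_thirtyTwo (Φ : CMType K) (hΦ : residueSet 32 Φ = {1, 3, 5, 7, 9, 11, 13, 15}) :
    5 ≤ cmTypeRank Φ := by
  classical
  have hu : ∀ i : Fin 5, ((![1, 3, 5, 7, 17] : Fin 5 → ZMod 32) i).val.Coprime 32 := by decide
  have hc : ∀ j : Fin 5, ((![1, 3, 5, 7, 17] : Fin 5 → ZMod 32) j).val.Coprime 32 := by decide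
  choose τ hτ using fun i : Fin 5 => exists_autExp_eq 32 _ (hu i)
  choose σ hσ using fun j : Fin 5 => exists_expOf_eq 32 K _ (hc j)
  let f : Fin 5 → (K →+* ℂ) → ℚ := fun i => translateInd Φ.1 (τ i)
  have hval : ∀ i j : Fin 5, f i (σ j) =
      if (![1, 3, 5, 7, 17] : Fin 5 → ZMod 32) i * (![1, 3, 5, 7, 17] : Fin 5 → ZMod 32) j ∈
        ({1, 3, 5, 7, 9, 11, 13, 15} : Finset (ZMod 32)) then (1 : ℚ) else 0 := by
    intro i j
    show translateInd Φ.1 (τ i) (σ j) = _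
    rw [translateInd_eq_ite₈, hτ, hσ, hΦ]
  have hli : LinearIndependent ℚ f := by
    rw [Fintype.linearIndependent_iff]
    intro g hg
    have heval : ∀ j : Fin 5, ∑ i, g i * f i (σ j) = 0 := fun j => by
      have := congrFun hg (σ j)
      simpa only [Finset.sum_apply, Pi.smul_apply, smul_eq_mul, Pi.zero_apply] using this
    have e0 := heval 0
    have e1 := heval 1
    have e2 := heval 2
    have e3 := heval 3
    have e4 := heval 4
    simp (config := { decide := true }) [Fin.sum_univ_succ, hval] at e0 e1 e2 e3 e4
    intro i
    fin_cases i <;> simp <;> linarith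
  have h1 : Module.finrank ℚ (Submodule.span ℚ (Set.range f)) = 5 := by
    rw [finrank_span_eq_card hli, Fintype.card_fin]
  have h2 : Submodule.span ℚ (Set.range f) ≤
      Submodule.span ℚ (Set.range fun g : ℂ ≃+* ℂ => translateInd Φ.1 g) :=
    Submodule.span_mono (by rintro _ ⟨i, rfl⟩; exact ⟨τ i, rfl⟩)
  have h3 := Submodule.finrank_mono h2
  rw [h1] at h3
  exact h3

/-- **`Rank(Φ) ≥ 5` for the type with residue set `{1, 3, 5, 9, 17, 19, 21, 25}`** (`I2`): the translates by the automorphisms of `ℂ` with cyclotomic characters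
`1, 3, 5, 7, 9`, read at the embeddings with exponents `1, 3, 5, 7, 9`, are linearly independent (the `5 × 5` minor of
`([u·c ∈ S])` has determinant `-2`). [cite: Kubota1965, §2 (p. 115)] [cite: GreenGriffithsKerr2012, (V.A.7)–(V.A.8)] -/
private theorem five_le_cmTypeRank_of_residueSet_eq_I2_thirtyTwo (Φ : CMType K) (hΦ : residueSet 32 Φ = {1, 3, 5, 9, 17, 19, 21, 25}) :
    5 ≤ cmTypeRank Φ := by
  classical
  have hu : ∀ i : Fin 5, ((![1, 3, 5, 7, 9] : Fin 5 → ZMod 32) i).val.Coprime 32 := by decide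
  have hc : ∀ j : Fin 5, ((![1, 3, 5, 7, 9] : Fin 5 → ZMod 32) j).val.Coprime 32 := by decide
  choose τ hτ using fun i : Fin 5 => exists_autExp_eq 32 _ (hu i)
  choose σ hσ using fun j : Fin 5 => exists_expOf_eq 32 K _ (hc j)
  let f : Fin 5 → (K →+* ℂ) → ℚ := fun i => translateInd Φ.1 (τ i)
  have hval : ∀ i j : Fin 5, f i (σ j) =
      if (![1, 3, 5, 7, 9] : Fin 5 → ZMod 32) i * (![1, 3, 5, 7, 9] : Fin 5 → ZMod 32) j ∈
        ({1, 3, 5, 9, 17, 19, 21, 25} : Finset (ZMod 32)) then (1 : ℚ) else 0 := by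
    intro i j
    show translateInd Φ.1 (τ i) (σ j) = _
    rw [translateInd_eq_ite₈, hτ, hσ, hΦ]
  have hli : LinearIndependent ℚ f := by
    rw [Fintype.linearIndependent_iff]
    intro g hg
    have heval : ∀ j : Fin 5, ∑ i, g i * f i (σ j) = 0 := fun j => by
      have := congrFun hg (σ j)
      simpa only [Finset.sum_apply, Pi.smul_apply, smul_eq_mul, Pi.zero_apply] using this
    have e0 := heval 0
    have e1 := heval 1
    have e2 := heval 2
    have e3 := heval 3
    have e4 := heval 4
    simp (config := { decide := true }) [Fin.sum_univ_succ, hval] at e0 e1 e2 e3 e4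
    intro i
    fin_cases i <;> simp <;> linarith
  have h1 : Module.finrank ℚ (Submodule.span ℚ (Set.range f)) = 5 := by
    rw [finrank_span_eq_card hli, Fintype.card_fin]
  have h2 : Submodule.span ℚ (Set.range f) ≤
      Submodule.span ℚ (Set.range fun g : ℂ ≃+* ℂ => translateInd Φ.1 g) :=
    Submodule.span_mono (by rintro _ ⟨i, rfl⟩; exact ⟨τ i, rfl⟩)
  have h3 := Submodule.finrank_mono h2
  rw [h1] at h3
  exact h3

/-- **`Rank(Φ) ≥ 5` for the type with residue set `{1, 3, 13, 15, 21, 23, 25, 27}`** (`I3`): the translates by the automorphisms of `ℂ` with cyclotomic characters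
`1, 3, 5, 7, 17`, read at the embeddings with exponents `1, 3, 5, 7, 17`, are linearly independent (the `5 × 5` minor of
`([u·c ∈ S])` has determinant `1`). [cite: Kubota1965, §2 (p. 115)] [cite: GreenGriffithsKerr2012, (V.A.7)–(V.A.8)] -/
private theorem five_le_cmTypeRank_of_residueSet_eq_I3_thirtyTwo (Φ : CMType K) (hΦ : residueSet 32 Φ = {1, 3, 13, 15, 21, 23, 25, 27}) :
    5 ≤ cmTypeRank Φ := by
  classical
  have hu : ∀ i : Fin 5, ((![1, 3, 5, 7, 17] : Fin 5 → ZMod 32) i).val.Coprime 32 := by decide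
  have hc : ∀ j : Fin 5, ((![1, 3, 5, 7, 17] : Fin 5 → ZMod 32) j).val.Coprime 32 := by decide
  choose τ hτ using fun i : Fin 5 => exists_autExp_eq 32 _ (hu i)
  choose σ hσ using fun j : Fin 5 => exists_expOf_eq 32 K _ (hc j)
  let f : Fin 5 → (K →+* ℂ) → ℚ := fun i => translateInd Φ.1 (τ i)
  have hval : ∀ i j : Fin 5, f i (σ j) =
      if (![1, 3, 5, 7, 17] : Fin 5 → ZMod 32) i * (![1, 3, 5, 7, 17] : Fin 5 → ZMod 32) j ∈
        ({1, 3, 13, 15, 21, 23, 25, 27} : Finset (ZMod 32)) then (1 : ℚ) else 0 := by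
    intro i j
    show translateInd Φ.1 (τ i) (σ j) = _
    rw [translateInd_eq_ite₈, hτ, hσ, hΦ]
  have hli : LinearIndependent ℚ f := by
    rw [Fintype.linearIndependent_iff]
    intro g hg
    have heval : ∀ j : Fin 5, ∑ i, g i * f i (σ j) = 0 := fun j => by
      have := congrFun hg (σ j)
      simpa only [Finset.sum_apply, Pi.smul_apply, smul_eq_mul, Pi.zero_apply] using this
    have e0 := heval 0
    have e1 := heval 1
    have e2 := heval 2
    have e3 := heval 3
    have e4 := heval 4
    simp (config := { decide := true }) [Fin.sum_univ_succ, hval] at e0 e1 e2 e3 e4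
    intro i
    fin_cases i <;> simp <;> linarith
  have h1 : Module.finrank ℚ (Submodule.span ℚ (Set.range f)) = 5 := by
    rw [finrank_span_eq_card hli, Fintype.card_fin]
  have h2 : Submodule.span ℚ (Set.range f) ≤
      Submodule.span ℚ (Set.range fun g : ℂ ≃+* ℂ => translateInd Φ.1 g) :=
    Submodule.span_mono (by rintro _ ⟨i, rfl⟩; exact ⟨τ i, rfl⟩)
  have h3 := Submodule.finrank_mono h2
  rw [h1] at h3
  exact h3

/-- **`Rank = 9 = n + 1` for the types whose residue set is one of the eight NOT coset-balanced representatives** (Kubota's bound `Rank ≤ n + 1`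
and the `9 × 9` certificates). [cite: Kubota1965, §2 (p. 115)] [cite: Gordon1999HodgeAVSurvey, §9.4.1] -/
theorem cmTypeRank_eq_nine_of_residueSet_mem_thirtyTwo (Φ : CMType K)
    (hΦ : residueSet 32 Φ ∈ ({{1, 3, 5, 7, 9, 11, 13, 17}, {1, 3, 5, 7, 9, 11, 15, 19}, {1, 3, 5, 7, 9, 13, 15, 21}, {1, 3, 5, 7, 9, 17, 19, 21}, {1, 3, 5, 7, 11, 17, 19, 23}, {1, 3, 5, 9, 11, 17, 19, 25}, {1, 3, 5, 9, 13, 17, 21, 25}, {1, 3, 13, 17, 21, 23, 25, 27}} : Finset (Finset (ZMod 32)))) :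
    cmTypeRank Φ = 9 := by
  haveI := isCMField₈ K
  refine le_antisymm ?_ ?_
  · have h := cmTypeRank_le Φ
    rw [finrank_eq_sixteen₈ K] at h
    exact h
  · simp only [Finset.mem_insert, Finset.mem_singleton] at hΦ
    rcases hΦ with h | h | h | h | h | h | h | h
    · exact nine_le_cmTypeRank_of_residueSet_eq_N1_thirtyTwo Φ h
    · exact nine_le_cmTypeRank_of_residueSet_eq_N2_thirtyTwo Φ h
    · exact nine_le_cmTypeRank_of_residueSet_eq_N3_thirtyTwo Φ h
    · exact nine_le_cmTypeRank_of_residueSet_eq_N4_thirtyTwo Φ h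
    · exact nine_le_cmTypeRank_of_residueSet_eq_N5_thirtyTwo Φ h
    · exact nine_le_cmTypeRank_of_residueSet_eq_N6_thirtyTwo Φ h
    · exact nine_le_cmTypeRank_of_residueSet_eq_N7_thirtyTwo Φ h
    · exact nine_le_cmTypeRank_of_residueSet_eq_N8_thirtyTwo Φ h

/-- **`Rank = 8` EXACTLY for the type with residue set `{1, 3, 5, 7, 9, 13, 17, 21}`** (`D1`): `≥ 8` by the certificate, `≤ 8` by Yanai's bound with
`W = {1, 3, 9, 11, 17, 19, 25, 27}` (`|W| · 2·1 = 16`: `Rank + 1 ≤ 9`). [cite: Gordon1999HodgeAVSurvey, 9.4.3 (Theorem [B.140])] -/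
theorem cmTypeRank_eq_of_residueSet_eq_D1_thirtyTwo (Φ : CMType K) (hΦ : residueSet 32 Φ = {1, 3, 5, 7, 9, 13, 17, 21}) : cmTypeRank Φ = 8 := by
  obtain ⟨⟨hu0, h10, hm0, hn0, hc0⟩, ⟨hu1, h11, hm1, hn1, hc1⟩, ⟨hu2, h12, hm2, hn2, hc2⟩, ⟨hu3, h13, hm3, hn3, hc3⟩, ⟨hu4, h14, hm4, hn4, hc4⟩⟩ := subgroups_thirtyTwo
  obtain ⟨hb0, hb1, hb2, hb3, hb4, hb5, hb6, hb7⟩ := cosetBalanced_reps_thirtyTwo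
  refine le_antisymm ?_ (eight_le_cmTypeRank_of_residueSet_eq_D1_thirtyTwo Φ hΦ)
  have h := cmTypeRank_add_le_of_cosetBalanced Φ hu2 h12 hm2 hn2 (by rw [hΦ]; exact hb0) (m := 1) (by rw [hc2]; decide +kernel)
  have h16 : Nat.totient 32 / 2 = 8 := by decide +kernel
  omega

/-- **`Rank = 8` EXACTLY for the type with residue set `{1, 3, 5, 7, 13, 15, 21, 23}`** (`D2`): `≥ 8` by the certificate, `≤ 8` by Yanai's bound with
`W = {1, 5, 9, 13, 17, 21, 25, 29}` (`|W| · 2·1 = 16`: `Rank + 1 ≤ 9`). [cite: Gordon1999HodgeAVSurvey, 9.4.3 (Theorem [B.140])] -/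
theorem cmTypeRank_eq_of_residueSet_eq_D2_thirtyTwo (Φ : CMType K) (hΦ : residueSet 32 Φ = {1, 3, 5, 7, 13, 15, 21, 23}) : cmTypeRank Φ = 8 := by
  obtain ⟨⟨hu0, h10, hm0, hn0, hc0⟩, ⟨hu1, h11, hm1, hn1, hc1⟩, ⟨hu2, h12, hm2, hn2, hc2⟩, ⟨hu3, h13, hm3, hn3, hc3⟩, ⟨hu4, h14, hm4, hn4, hc4⟩⟩ := subgroups_thirtyTwo
  obtain ⟨hb0, hb1, hb2, hb3, hb4, hb5, hb6, hb7⟩ := cosetBalanced_reps_thirtyTwo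
  refine le_antisymm ?_ (eight_le_cmTypeRank_of_residueSet_eq_D2_thirtyTwo Φ hΦ)
  have h := cmTypeRank_add_le_of_cosetBalanced Φ hu3 h13 hm3 hn3 (by rw [hΦ]; exact hb1) (m := 1) (by rw [hc3]; decide +kernel)
  have h16 : Nat.totient 32 / 2 = 8 := by decide +kernel
  omega

/-- **`Rank = 8` EXACTLY for the type with residue set `{1, 3, 5, 13, 17, 21, 23, 25}`** (`D3`): `≥ 8` by the certificate, `≤ 8` by Yanai's bound with
`W = {1, 3, 9, 11, 17, 19, 25, 27}` (`|W| · 2·1 = 16`: `Rank + 1 ≤ 9`). [cite: Gordon1999HodgeAVSurvey, 9.4.3 (Theorem [B.140])] -/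
theorem cmTypeRank_eq_of_residueSet_eq_D3_thirtyTwo (Φ : CMType K) (hΦ : residueSet 32 Φ = {1, 3, 5, 13, 17, 21, 23, 25}) : cmTypeRank Φ = 8 := by
  obtain ⟨⟨hu0, h10, hm0, hn0, hc0⟩, ⟨hu1, h11, hm1, hn1, hc1⟩, ⟨hu2, h12, hm2, hn2, hc2⟩, ⟨hu3, h13, hm3, hn3, hc3⟩, ⟨hu4, h14, hm4, hn4, hc4⟩⟩ := subgroups_thirtyTwo
  obtain ⟨hb0, hb1, hb2, hb3, hb4, hb5, hb6, hb7⟩ := cosetBalanced_reps_thirtyTwo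
  refine le_antisymm ?_ (eight_le_cmTypeRank_of_residueSet_eq_D3_thirtyTwo Φ hΦ)
  have h := cmTypeRank_add_le_of_cosetBalanced Φ hu2 h12 hm2 hn2 (by rw [hΦ]; exact hb2) (m := 1) (by rw [hc2]; decide +kernel)
  have h16 : Nat.totient 32 / 2 = 8 := by decide +kernel
  omega

/-- **`Rank = 8` EXACTLY for the type with residue set `{1, 7, 13, 15, 21, 23, 27, 29}`** (`D4`): `≥ 8` by the certificate, `≤ 8` by Yanai's bound with
`W = {1, 5, 9, 13, 17, 21, 25, 29}` (`|W| · 2·1 = 16`: `Rank + 1 ≤ 9`). [cite: Gordon1999HodgeAVSurvey, 9.4.3 (Theorem [B.140])] -/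
theorem cmTypeRank_eq_of_residueSet_eq_D4_thirtyTwo (Φ : CMType K) (hΦ : residueSet 32 Φ = {1, 7, 13, 15, 21, 23, 27, 29}) : cmTypeRank Φ = 8 := by
  obtain ⟨⟨hu0, h10, hm0, hn0, hc0⟩, ⟨hu1, h11, hm1, hn1, hc1⟩, ⟨hu2, h12, hm2, hn2, hc2⟩, ⟨hu3, h13, hm3, hn3, hc3⟩, ⟨hu4, h14, hm4, hn4, hc4⟩⟩ := subgroups_thirtyTwo
  obtain ⟨hb0, hb1, hb2, hb3, hb4, hb5, hb6, hb7⟩ := cosetBalanced_reps_thirtyTwo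
  refine le_antisymm ?_ (eight_le_cmTypeRank_of_residueSet_eq_D4_thirtyTwo Φ hΦ)
  have h := cmTypeRank_add_le_of_cosetBalanced Φ hu3 h13 hm3 hn3 (by rw [hΦ]; exact hb3) (m := 1) (by rw [hc3]; decide +kernel)
  have h16 : Nat.totient 32 / 2 = 8 := by decide +kernel
  omega

/-- **`Rank = 7` EXACTLY for the type with residue set `{1, 3, 5, 9, 11, 13, 17, 25}`** (`D5`): `≥ 7` by the certificate, `≤ 7` by Yanai's bound with
`W = {1, 7, 17, 23}` (`|W| · 2·2 = 16`: `Rank + 2 ≤ 9`). [cite: Gordon1999HodgeAVSurvey, 9.4.3 (Theorem [B.140])] [cite: GreenGriffithsKerr2012, (V.D.8)] -/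
theorem cmTypeRank_eq_of_residueSet_eq_D5_thirtyTwo (Φ : CMType K) (hΦ : residueSet 32 Φ = {1, 3, 5, 9, 11, 13, 17, 25}) : cmTypeRank Φ = 7 := by
  obtain ⟨⟨hu0, h10, hm0, hn0, hc0⟩, ⟨hu1, h11, hm1, hn1, hc1⟩, ⟨hu2, h12, hm2, hn2, hc2⟩, ⟨hu3, h13, hm3, hn3, hc3⟩, ⟨hu4, h14, hm4, hn4, hc4⟩⟩ := subgroups_thirtyTwo
  obtain ⟨hb0, hb1, hb2, hb3, hb4, hb5, hb6, hb7⟩ := cosetBalanced_reps_thirtyTwo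
  refine le_antisymm ?_ (seven_le_cmTypeRank_of_residueSet_eq_D5_thirtyTwo Φ hΦ)
  have h := cmTypeRank_add_le_of_cosetBalanced Φ hu1 h11 hm1 hn1 (by rw [hΦ]; exact hb4) (m := 2) (by rw [hc1]; decide +kernel)
  have h16 : Nat.totient 32 / 2 = 8 := by decide +kernel
  omega

/-- **`Rank = 7` EXACTLY for the type with residue set `{1, 7, 9, 11, 13, 15, 27, 29}`** (`D6`): `≥ 7` by the certificate, `≤ 7` by Yanai's bound with
`W = {1, 9, 17, 25}` (`|W| · 2·2 = 16`: `Rank + 2 ≤ 9`). [cite: Gordon1999HodgeAVSurvey, 9.4.3 (Theorem [B.140])] [cite: GreenGriffithsKerr2012, (V.D.8)] -/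
theorem cmTypeRank_eq_of_residueSet_eq_D6_thirtyTwo (Φ : CMType K) (hΦ : residueSet 32 Φ = {1, 7, 9, 11, 13, 15, 27, 29}) : cmTypeRank Φ = 7 := by
  obtain ⟨⟨hu0, h10, hm0, hn0, hc0⟩, ⟨hu1, h11, hm1, hn1, hc1⟩, ⟨hu2, h12, hm2, hn2, hc2⟩, ⟨hu3, h13, hm3, hn3, hc3⟩, ⟨hu4, h14, hm4, hn4, hc4⟩⟩ := subgroups_thirtyTwo
  obtain ⟨hb0, hb1, hb2, hb3, hb4, hb5, hb6, hb7⟩ := cosetBalanced_reps_thirtyTwo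
  refine le_antisymm ?_ (seven_le_cmTypeRank_of_residueSet_eq_D6_thirtyTwo Φ hΦ)
  have h := cmTypeRank_add_le_of_cosetBalanced Φ hu4 h14 hm4 hn4 (by rw [hΦ]; exact hb7) (m := 2) (by rw [hc4]; decide +kernel)
  have h16 : Nat.totient 32 / 2 = 8 := by decide +kernel
  omega

/-- **`Rank = 5` EXACTLY for the type with residue set `{1, 3, 5, 7, 9, 11, 13, 15}`** (`I1`, stabiliser `{1, 15}`: induced from a primitive
NONDEGENERATE type of an octic CM subfield): `≥ 5` by the certificate, `≤ 5` by the induced-type bound.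
[cite: Kubota1965, §2 (p. 115)] [cite: KoblitzRohrlich1978, §1 p. 1184] -/
theorem cmTypeRank_eq_of_residueSet_eq_I1_thirtyTwo (Φ : CMType K) (hΦ : residueSet 32 Φ = {1, 3, 5, 7, 9, 11, 13, 15}) : cmTypeRank Φ = 5 := by
  obtain ⟨⟨hs0, hi0⟩, ⟨hs1, hi1⟩, ⟨hs2, hi2⟩, ⟨hs3, hi3⟩, ⟨hs4, hi4⟩, ⟨hs5, hi5⟩⟩ := stabilizer_reps_thirtyTwo
  refine le_antisymm ?_ (five_le_cmTypeRank_of_residueSet_eq_I1_thirtyTwo Φ hΦ)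
  exact cmTypeRank_le_succ_of_card_stabilizer_mul_eq (N := 32) (by norm_num) Φ (k := 4) (by rw [hΦ, hs0]; decide +kernel)

/-- **`Rank = 5` EXACTLY for the type with residue set `{1, 3, 5, 9, 17, 19, 21, 25}`** (`I2`, stabiliser `{1, 17}`: induced from a primitive
NONDEGENERATE type of an octic CM subfield): `≥ 5` by the certificate, `≤ 5` by the induced-type bound.
[cite: Kubota1965, §2 (p. 115)] [cite: KoblitzRohrlich1978, §1 p. 1184] -/
theorem cmTypeRank_eq_of_residueSet_eq_I2_thirtyTwo (Φ : CMType K) (hΦ : residueSet 32 Φ = {1, 3, 5, 9, 17, 19, 21, 25}) : cmTypeRank Φ = 5 := by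
  obtain ⟨⟨hs0, hi0⟩, ⟨hs1, hi1⟩, ⟨hs2, hi2⟩, ⟨hs3, hi3⟩, ⟨hs4, hi4⟩, ⟨hs5, hi5⟩⟩ := stabilizer_reps_thirtyTwo
  refine le_antisymm ?_ (five_le_cmTypeRank_of_residueSet_eq_I2_thirtyTwo Φ hΦ)
  exact cmTypeRank_le_succ_of_card_stabilizer_mul_eq (N := 32) (by norm_num) Φ (k := 4) (by rw [hΦ, hs1]; decide +kernel)

/-- **`Rank = 5` EXACTLY for the type with residue set `{1, 3, 13, 15, 21, 23, 25, 27}`** (`I3`, stabiliser `{1, 15}`: induced from a primitive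
NONDEGENERATE type of an octic CM subfield): `≥ 5` by the certificate, `≤ 5` by the induced-type bound.
[cite: Kubota1965, §2 (p. 115)] [cite: KoblitzRohrlich1978, §1 p. 1184] -/
theorem cmTypeRank_eq_of_residueSet_eq_I3_thirtyTwo (Φ : CMType K) (hΦ : residueSet 32 Φ = {1, 3, 13, 15, 21, 23, 25, 27}) : cmTypeRank Φ = 5 := by
  obtain ⟨⟨hs0, hi0⟩, ⟨hs1, hi1⟩, ⟨hs2, hi2⟩, ⟨hs3, hi3⟩, ⟨hs4, hi4⟩, ⟨hs5, hi5⟩⟩ := stabilizer_reps_thirtyTwo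
  refine le_antisymm ?_ (five_le_cmTypeRank_of_residueSet_eq_I3_thirtyTwo Φ hΦ)
  exact cmTypeRank_le_succ_of_card_stabilizer_mul_eq (N := 32) (by norm_num) Φ (k := 4) (by rw [hΦ, hs2]; decide +kernel)

/-- **`Rank = 3` for the types of `ℚ(ζ₃₂)` with residue stabiliser of order `4`** (induced from a quartic CM subfield, `[K₁ : ℚ] = 2·2`).
[cite: Kubota1965, §2 (p. 115)] [cite: KoblitzRohrlich1978, §1 p. 1184] -/
theorem cmTypeRank_eq_three_of_card_stabilizer_eq_four_thirtyTwo (Φ : CMType K) (hW : ((unitResidues 32).filter fun t => ∀ c ∈ unitResidues 32, (c * t ∈ residueSet 32 Φ ↔ c ∈ residueSet 32 Φ)).card = 4) :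
    cmTypeRank Φ = 3 :=
  cmTypeRank_eq_succ_of_card_stabilizer_mul_eq (N := 32) (by norm_num) Nat.prime_two Φ (by rw [hW]; decide +kernel)

/-- **`Rank = 2` for the types of `ℚ(ζ₃₂)` with residue stabiliser of order `8`** (induced from an imaginary quadratic subfield).
[cite: Kubota1965, §2 (p. 115)] -/
theorem cmTypeRank_eq_two_of_card_stabilizer_eq_eight_thirtyTwo (Φ : CMType K) (hW : ((unitResidues 32).filter fun t => ∀ c ∈ unitResidues 32, (c * t ∈ residueSet 32 Φ ↔ c ∈ residueSet 32 Φ)).card = 8) :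
    cmTypeRank Φ = 2 :=
  cmTypeRank_eq_two_of_two_mul_card_filter_eq (N := 32) (by norm_num) Φ (by rw [hW]; decide +kernel)

/-- **`Rank ≤ 5` for the types of `ℚ(ζ₃₂)` with residue stabiliser of order `2`** (induced from an octic CM subfield).
[cite: Kubota1965, §2 (p. 115)] [cite: KoblitzRohrlich1978, §1 p. 1184] -/
theorem cmTypeRank_le_five_of_card_stabilizer_eq_two_thirtyTwo (Φ : CMType K) (hW : ((unitResidues 32).filter fun t => ∀ c ∈ unitResidues 32, (c * t ∈ residueSet 32 Φ ↔ c ∈ residueSet 32 Φ)).card = 2) :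
    cmTypeRank Φ ≤ 5 :=
  cmTypeRank_le_succ_of_card_stabilizer_mul_eq (N := 32) (by norm_num) Φ (k := 4) (by rw [hW]; decide +kernel)

/-- **`Rank = 9` FOR EVERY TYPE OF `ℚ(ζ₃₂)` NOT COSET-BALANCED for any maximal `(−1)`-free subgroup** (it is the transform of one of the eight
representatives, and the rank is an invariant of the family). [cite: Gordon1999HodgeAVSurvey, §9.4.1] [cite: Shimura1998, §8.4 Example (1)] -/
theorem cmTypeRank_eq_nine_of_not_cosetBalanced_thirtyTwo (Φ : CMType K)
    (h : ¬((∀ c ∈ unitResidues 32, ((({1, 15} : Finset (ZMod 32))).filter fun w => c * w ∈ residueSet 32 Φ).card = ((({1, 15} : Finset (ZMod 32))).filter fun w => c * w ∉ residueSet 32 Φ).card) ∨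
      (∀ c ∈ unitResidues 32, ((({1, 7, 17, 23} : Finset (ZMod 32))).filter fun w => c * w ∈ residueSet 32 Φ).card = ((({1, 7, 17, 23} : Finset (ZMod 32))).filter fun w => c * w ∉ residueSet 32 Φ).card) ∨
      (∀ c ∈ unitResidues 32, ((({1, 3, 9, 11, 17, 19, 25, 27} : Finset (ZMod 32))).filter fun w => c * w ∈ residueSet 32 Φ).card = ((({1, 3, 9, 11, 17, 19, 25, 27} : Finset (ZMod 32))).filter fun w => c * w ∉ residueSet 32 Φ).card) ∨
      (∀ c ∈ unitResidues 32, ((({1, 5, 9, 13, 17, 21, 25, 29} : Finset (ZMod 32))).filter fun w => c * w ∈ residueSet 32 Φ).card = ((({1, 5, 9, 13, 17, 21, 25, 29} : Finset (ZMod 32))).filter fun w => c * w ∉ residueSet 32 Φ).card))) :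
    cmTypeRank Φ = 9 := by
  obtain ⟨φ₀⟩ : Nonempty (K →+* ℂ) := inferInstance
  obtain ⟨Ψ, hΨ, hT⟩ := (exists_isAutTransform_thirtyTwo Φ φ₀).1 h
  rw [cmTypeRank_eq_of_isAutTransform hT]
  exact cmTypeRank_eq_nine_of_residueSet_mem_thirtyTwo Ψ hΨ

/-- **`Rank ≤ 8` for every type COSET-BALANCED for some maximal `(−1)`-free subgroup** (Yanai: degenerate).
[cite: Gordon1999HodgeAVSurvey, 9.4.3 (Theorem [B.140])] -/
theorem cmTypeRank_le_eight_of_cosetBalanced_thirtyTwo (Φ : CMType K)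
    (h : ((∀ c ∈ unitResidues 32, ((({1, 15} : Finset (ZMod 32))).filter fun w => c * w ∈ residueSet 32 Φ).card = ((({1, 15} : Finset (ZMod 32))).filter fun w => c * w ∉ residueSet 32 Φ).card) ∨
      (∀ c ∈ unitResidues 32, ((({1, 7, 17, 23} : Finset (ZMod 32))).filter fun w => c * w ∈ residueSet 32 Φ).card = ((({1, 7, 17, 23} : Finset (ZMod 32))).filter fun w => c * w ∉ residueSet 32 Φ).card) ∨
      (∀ c ∈ unitResidues 32, ((({1, 3, 9, 11, 17, 19, 25, 27} : Finset (ZMod 32))).filter fun w => c * w ∈ residueSet 32 Φ).card = ((({1, 3, 9, 11, 17, 19, 25, 27} : Finset (ZMod 32))).filter fun w => c * w ∉ residueSet 32 Φ).card) ∨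
      (∀ c ∈ unitResidues 32, ((({1, 5, 9, 13, 17, 21, 25, 29} : Finset (ZMod 32))).filter fun w => c * w ∈ residueSet 32 Φ).card = ((({1, 5, 9, 13, 17, 21, 25, 29} : Finset (ZMod 32))).filter fun w => c * w ∉ residueSet 32 Φ).card))) :
    cmTypeRank Φ ≤ 8 := by
  obtain ⟨⟨hu0, h10, hm0, hn0, hc0⟩, ⟨hu1, h11, hm1, hn1, hc1⟩, ⟨hu2, h12, hm2, hn2, hc2⟩, ⟨hu3, h13, hm3, hn3, hc3⟩, ⟨hu4, h14, hm4, hn4, hc4⟩⟩ := subgroups_thirtyTwo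
  rw [show (8 : ℕ) = Nat.totient 32 / 2 by decide +kernel]
  rcases h with h | h | h | h
  · exact cmTypeRank_le_of_cosetBalanced Φ hu0 h10 hm0 hn0 h
  · exact cmTypeRank_le_of_cosetBalanced Φ hu1 h11 hm1 hn1 h
  · exact cmTypeRank_le_of_cosetBalanced Φ hu2 h12 hm2 hn2 h
  · exact cmTypeRank_le_of_cosetBalanced Φ hu3 h13 hm3 hn3 h

omit [IsCyclotomicExtension {32} ℚ K] in
/-- **NONDEGENERATE ⟺ NOT COSET-BALANCED for any maximal `(−1)`-free subgroup, for the CM types of `ℚ(ζ₃₂)`** — the residue form of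
«nondegenerate ⟺ equidistributed over no odd character» for this abelian field of `2`-power degree. [cite: Gordon1999HodgeAVSurvey, §9.4.1 and 9.4.3]
[cite: Kubota1965, §4 Lemma 2] -/
theorem isNondegenerate_iff_not_cosetBalanced_thirtyTwo (hK : IsCyclotomicExtension {32} ℚ K) (Φ : CMType K) :
    IsNondegenerate Φ ↔ ¬((∀ c ∈ unitResidues 32, ((({1, 15} : Finset (ZMod 32))).filter fun w => c * w ∈ residueSet 32 Φ).card = ((({1, 15} : Finset (ZMod 32))).filter fun w => c * w ∉ residueSet 32 Φ).card) ∨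
      (∀ c ∈ unitResidues 32, ((({1, 7, 17, 23} : Finset (ZMod 32))).filter fun w => c * w ∈ residueSet 32 Φ).card = ((({1, 7, 17, 23} : Finset (ZMod 32))).filter fun w => c * w ∉ residueSet 32 Φ).card) ∨
      (∀ c ∈ unitResidues 32, ((({1, 3, 9, 11, 17, 19, 25, 27} : Finset (ZMod 32))).filter fun w => c * w ∈ residueSet 32 Φ).card = ((({1, 3, 9, 11, 17, 19, 25, 27} : Finset (ZMod 32))).filter fun w => c * w ∉ residueSet 32 Φ).card) ∨
      (∀ c ∈ unitResidues 32, ((({1, 5, 9, 13, 17, 21, 25, 29} : Finset (ZMod 32))).filter fun w => c * w ∈ residueSet 32 Φ).card = ((({1, 5, 9, 13, 17, 21, 25, 29} : Finset (ZMod 32))).filter fun w => c * w ∉ residueSet 32 Φ).card)) := by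
  haveI := isCMField₈ K
  rw [isNondegenerate_iff, finrank_eq_sixteen₈ K]
  constructor
  · intro h9 hb
    have h8 := cmTypeRank_le_eight_of_cosetBalanced_thirtyTwo Φ hb
    omega
  · intro h
    exact cmTypeRank_eq_nine_of_not_cosetBalanced_thirtyTwo Φ h

omit [IsCyclotomicExtension {32} ℚ K] in
/-- **Exactly `128` of the `256` CM types of `ℚ(ζ₃₂)` are nondegenerate** (eight free families of `16`). [cite: Gordon1999HodgeAVSurvey, §9.4.1]
[cite: Shimura1998, §8.4 Example (1)] -/
theorem ncard_isNondegenerate_thirtyTwo (hK : IsCyclotomicExtension {32} ℚ K) : {Φ : CMType K | IsNondegenerate Φ}.ncard = 128 := by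
  obtain ⟨φ₀⟩ : Nonempty (K →+* ℂ) := inferInstance
  have h := (ncard_not_cosetBalanced_thirtyTwo hK φ₀).1
  rw [← h]
  congr 1
  ext Φ
  exact isNondegenerate_iff_not_cosetBalanced_thirtyTwo hK Φ

/-- The maximal `(−1)`-free subgroups over which the degenerate primitive representatives are NOT balanced (the complement of the census's
`cosetBalanced_reps_thirtyTwo` within the maximal subgroups). [cite: Gordon1999HodgeAVSurvey, §9.4.1] -/
private theorem not_cosetBalanced_deg_reps_thirtyTwo :
    ¬(∀ c ∈ unitResidues 32, ((({1, 15} : Finset (ZMod 32))).filter fun w => c * w ∈ ({1, 3, 5, 7, 9, 13, 17, 21} : Finset (ZMod 32))).card = ((({1, 15} : Finset (ZMod 32))).filter fun w => c * w ∉ ({1, 3, 5, 7, 9, 13, 17, 21} : Finset (ZMod 32))).card) ∧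
    ¬(∀ c ∈ unitResidues 32, ((({1, 7, 17, 23} : Finset (ZMod 32))).filter fun w => c * w ∈ ({1, 3, 5, 7, 9, 13, 17, 21} : Finset (ZMod 32))).card = ((({1, 7, 17, 23} : Finset (ZMod 32))).filter fun w => c * w ∉ ({1, 3, 5, 7, 9, 13, 17, 21} : Finset (ZMod 32))).card) ∧
    ¬(∀ c ∈ unitResidues 32, ((({1, 5, 9, 13, 17, 21, 25, 29} : Finset (ZMod 32))).filter fun w => c * w ∈ ({1, 3, 5, 7, 9, 13, 17, 21} : Finset (ZMod 32))).card = ((({1, 5, 9, 13, 17, 21, 25, 29} : Finset (ZMod 32))).filter fun w => c * w ∉ ({1, 3, 5, 7, 9, 13, 17, 21} : Finset (ZMod 32))).card) ∧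
    ¬(∀ c ∈ unitResidues 32, ((({1, 15} : Finset (ZMod 32))).filter fun w => c * w ∈ ({1, 3, 5, 7, 13, 15, 21, 23} : Finset (ZMod 32))).card = ((({1, 15} : Finset (ZMod 32))).filter fun w => c * w ∉ ({1, 3, 5, 7, 13, 15, 21, 23} : Finset (ZMod 32))).card) ∧
    ¬(∀ c ∈ unitResidues 32, ((({1, 7, 17, 23} : Finset (ZMod 32))).filter fun w => c * w ∈ ({1, 3, 5, 7, 13, 15, 21, 23} : Finset (ZMod 32))).card = ((({1, 7, 17, 23} : Finset (ZMod 32))).filter fun w => c * w ∉ ({1, 3, 5, 7, 13, 15, 21, 23} : Finset (ZMod 32))).card) ∧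
    ¬(∀ c ∈ unitResidues 32, ((({1, 3, 9, 11, 17, 19, 25, 27} : Finset (ZMod 32))).filter fun w => c * w ∈ ({1, 3, 5, 7, 13, 15, 21, 23} : Finset (ZMod 32))).card = ((({1, 3, 9, 11, 17, 19, 25, 27} : Finset (ZMod 32))).filter fun w => c * w ∉ ({1, 3, 5, 7, 13, 15, 21, 23} : Finset (ZMod 32))).card) ∧
    ¬(∀ c ∈ unitResidues 32, ((({1, 15} : Finset (ZMod 32))).filter fun w => c * w ∈ ({1, 3, 5, 13, 17, 21, 23, 25} : Finset (ZMod 32))).card = ((({1, 15} : Finset (ZMod 32))).filter fun w => c * w ∉ ({1, 3, 5, 13, 17, 21, 23, 25} : Finset (ZMod 32))).card) ∧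
    ¬(∀ c ∈ unitResidues 32, ((({1, 7, 17, 23} : Finset (ZMod 32))).filter fun w => c * w ∈ ({1, 3, 5, 13, 17, 21, 23, 25} : Finset (ZMod 32))).card = ((({1, 7, 17, 23} : Finset (ZMod 32))).filter fun w => c * w ∉ ({1, 3, 5, 13, 17, 21, 23, 25} : Finset (ZMod 32))).card) ∧
    ¬(∀ c ∈ unitResidues 32, ((({1, 5, 9, 13, 17, 21, 25, 29} : Finset (ZMod 32))).filter fun w => c * w ∈ ({1, 3, 5, 13, 17, 21, 23, 25} : Finset (ZMod 32))).card = ((({1, 5, 9, 13, 17, 21, 25, 29} : Finset (ZMod 32))).filter fun w => c * w ∉ ({1, 3, 5, 13, 17, 21, 23, 25} : Finset (ZMod 32))).card) ∧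
    ¬(∀ c ∈ unitResidues 32, ((({1, 15} : Finset (ZMod 32))).filter fun w => c * w ∈ ({1, 7, 13, 15, 21, 23, 27, 29} : Finset (ZMod 32))).card = ((({1, 15} : Finset (ZMod 32))).filter fun w => c * w ∉ ({1, 7, 13, 15, 21, 23, 27, 29} : Finset (ZMod 32))).card) ∧
    ¬(∀ c ∈ unitResidues 32, ((({1, 7, 17, 23} : Finset (ZMod 32))).filter fun w => c * w ∈ ({1, 7, 13, 15, 21, 23, 27, 29} : Finset (ZMod 32))).card = ((({1, 7, 17, 23} : Finset (ZMod 32))).filter fun w => c * w ∉ ({1, 7, 13, 15, 21, 23, 27, 29} : Finset (ZMod 32))).card) ∧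
    ¬(∀ c ∈ unitResidues 32, ((({1, 3, 9, 11, 17, 19, 25, 27} : Finset (ZMod 32))).filter fun w => c * w ∈ ({1, 7, 13, 15, 21, 23, 27, 29} : Finset (ZMod 32))).card = ((({1, 3, 9, 11, 17, 19, 25, 27} : Finset (ZMod 32))).filter fun w => c * w ∉ ({1, 7, 13, 15, 21, 23, 27, 29} : Finset (ZMod 32))).card) ∧
    ¬(∀ c ∈ unitResidues 32, ((({1, 15} : Finset (ZMod 32))).filter fun w => c * w ∈ ({1, 3, 5, 9, 11, 13, 17, 25} : Finset (ZMod 32))).card = ((({1, 15} : Finset (ZMod 32))).filter fun w => c * w ∉ ({1, 3, 5, 9, 11, 13, 17, 25} : Finset (ZMod 32))).card) ∧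
    ¬(∀ c ∈ unitResidues 32, ((({1, 3, 9, 11, 17, 19, 25, 27} : Finset (ZMod 32))).filter fun w => c * w ∈ ({1, 3, 5, 9, 11, 13, 17, 25} : Finset (ZMod 32))).card = ((({1, 3, 9, 11, 17, 19, 25, 27} : Finset (ZMod 32))).filter fun w => c * w ∉ ({1, 3, 5, 9, 11, 13, 17, 25} : Finset (ZMod 32))).card) ∧
    ¬(∀ c ∈ unitResidues 32, ((({1, 5, 9, 13, 17, 21, 25, 29} : Finset (ZMod 32))).filter fun w => c * w ∈ ({1, 3, 5, 9, 11, 13, 17, 25} : Finset (ZMod 32))).card = ((({1, 5, 9, 13, 17, 21, 25, 29} : Finset (ZMod 32))).filter fun w => c * w ∉ ({1, 3, 5, 9, 11, 13, 17, 25} : Finset (ZMod 32))).card) ∧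
    ¬(∀ c ∈ unitResidues 32, ((({1, 15} : Finset (ZMod 32))).filter fun w => c * w ∈ ({1, 7, 9, 11, 13, 15, 27, 29} : Finset (ZMod 32))).card = ((({1, 15} : Finset (ZMod 32))).filter fun w => c * w ∉ ({1, 7, 9, 11, 13, 15, 27, 29} : Finset (ZMod 32))).card) ∧
    ¬(∀ c ∈ unitResidues 32, ((({1, 7, 17, 23} : Finset (ZMod 32))).filter fun w => c * w ∈ ({1, 7, 9, 11, 13, 15, 27, 29} : Finset (ZMod 32))).card = ((({1, 7, 17, 23} : Finset (ZMod 32))).filter fun w => c * w ∉ ({1, 7, 9, 11, 13, 15, 27, 29} : Finset (ZMod 32))).card) := by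
  refine ⟨?_, ?_, ?_, ?_, ?_, ?_, ?_, ?_, ?_, ?_, ?_, ?_, ?_, ?_, ?_, ?_, ?_⟩ <;> decide +kernel

/-- **THE RANKS OF THE PRIMITIVE COSET-BALANCED TYPES OF `ℚ(ζ₃₂)`, by their balance profile over the maximal `(−1)`-free subgroups** (each is the
transform of one of the 6 representatives; balance and rank are invariants of the family). [cite: Gordon1999HodgeAVSurvey, §9.4.2 and 9.4.3]
[cite: Shimura1998, §8.4 Example (1)] -/
theorem cmTypeRank_of_isPrimitive_of_cosetBalanced_thirtyTwo (Φ : CMType K) (φ₀ : K →+* ℂ) (hp : IsPrimitive (ℂ ≃+* ℂ) Φ.1 φ₀)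
    (hb : ((∀ c ∈ unitResidues 32, ((({1, 15} : Finset (ZMod 32))).filter fun w => c * w ∈ residueSet 32 Φ).card = ((({1, 15} : Finset (ZMod 32))).filter fun w => c * w ∉ residueSet 32 Φ).card) ∨
      (∀ c ∈ unitResidues 32, ((({1, 7, 17, 23} : Finset (ZMod 32))).filter fun w => c * w ∈ residueSet 32 Φ).card = ((({1, 7, 17, 23} : Finset (ZMod 32))).filter fun w => c * w ∉ residueSet 32 Φ).card) ∨
      (∀ c ∈ unitResidues 32, ((({1, 3, 9, 11, 17, 19, 25, 27} : Finset (ZMod 32))).filter fun w => c * w ∈ residueSet 32 Φ).card = ((({1, 3, 9, 11, 17, 19, 25, 27} : Finset (ZMod 32))).filter fun w => c * w ∉ residueSet 32 Φ).card) ∨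
      (∀ c ∈ unitResidues 32, ((({1, 5, 9, 13, 17, 21, 25, 29} : Finset (ZMod 32))).filter fun w => c * w ∈ residueSet 32 Φ).card = ((({1, 5, 9, 13, 17, 21, 25, 29} : Finset (ZMod 32))).filter fun w => c * w ∉ residueSet 32 Φ).card))) :
    ((¬(∀ c ∈ unitResidues 32, ((({1, 15} : Finset (ZMod 32))).filter fun w => c * w ∈ residueSet 32 Φ).card = ((({1, 15} : Finset (ZMod 32))).filter fun w => c * w ∉ residueSet 32 Φ).card) ∧
        ¬(∀ c ∈ unitResidues 32, ((({1, 7, 17, 23} : Finset (ZMod 32))).filter fun w => c * w ∈ residueSet 32 Φ).card = ((({1, 7, 17, 23} : Finset (ZMod 32))).filter fun w => c * w ∉ residueSet 32 Φ).card) ∧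
        (∀ c ∈ unitResidues 32, ((({1, 3, 9, 11, 17, 19, 25, 27} : Finset (ZMod 32))).filter fun w => c * w ∈ residueSet 32 Φ).card = ((({1, 3, 9, 11, 17, 19, 25, 27} : Finset (ZMod 32))).filter fun w => c * w ∉ residueSet 32 Φ).card) ∧
        ¬(∀ c ∈ unitResidues 32, ((({1, 5, 9, 13, 17, 21, 25, 29} : Finset (ZMod 32))).filter fun w => c * w ∈ residueSet 32 Φ).card = ((({1, 5, 9, 13, 17, 21, 25, 29} : Finset (ZMod 32))).filter fun w => c * w ∉ residueSet 32 Φ).card)) ∧ cmTypeRank Φ = 8) ∨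
    ((¬(∀ c ∈ unitResidues 32, ((({1, 15} : Finset (ZMod 32))).filter fun w => c * w ∈ residueSet 32 Φ).card = ((({1, 15} : Finset (ZMod 32))).filter fun w => c * w ∉ residueSet 32 Φ).card) ∧
        ¬(∀ c ∈ unitResidues 32, ((({1, 7, 17, 23} : Finset (ZMod 32))).filter fun w => c * w ∈ residueSet 32 Φ).card = ((({1, 7, 17, 23} : Finset (ZMod 32))).filter fun w => c * w ∉ residueSet 32 Φ).card) ∧
        ¬(∀ c ∈ unitResidues 32, ((({1, 3, 9, 11, 17, 19, 25, 27} : Finset (ZMod 32))).filter fun w => c * w ∈ residueSet 32 Φ).card = ((({1, 3, 9, 11, 17, 19, 25, 27} : Finset (ZMod 32))).filter fun w => c * w ∉ residueSet 32 Φ).card) ∧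
        (∀ c ∈ unitResidues 32, ((({1, 5, 9, 13, 17, 21, 25, 29} : Finset (ZMod 32))).filter fun w => c * w ∈ residueSet 32 Φ).card = ((({1, 5, 9, 13, 17, 21, 25, 29} : Finset (ZMod 32))).filter fun w => c * w ∉ residueSet 32 Φ).card)) ∧ cmTypeRank Φ = 8) ∨
    ((¬(∀ c ∈ unitResidues 32, ((({1, 15} : Finset (ZMod 32))).filter fun w => c * w ∈ residueSet 32 Φ).card = ((({1, 15} : Finset (ZMod 32))).filter fun w => c * w ∉ residueSet 32 Φ).card) ∧
        (∀ c ∈ unitResidues 32, ((({1, 7, 17, 23} : Finset (ZMod 32))).filter fun w => c * w ∈ residueSet 32 Φ).card = ((({1, 7, 17, 23} : Finset (ZMod 32))).filter fun w => c * w ∉ residueSet 32 Φ).card) ∧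
        ¬(∀ c ∈ unitResidues 32, ((({1, 3, 9, 11, 17, 19, 25, 27} : Finset (ZMod 32))).filter fun w => c * w ∈ residueSet 32 Φ).card = ((({1, 3, 9, 11, 17, 19, 25, 27} : Finset (ZMod 32))).filter fun w => c * w ∉ residueSet 32 Φ).card) ∧
        ¬(∀ c ∈ unitResidues 32, ((({1, 5, 9, 13, 17, 21, 25, 29} : Finset (ZMod 32))).filter fun w => c * w ∈ residueSet 32 Φ).card = ((({1, 5, 9, 13, 17, 21, 25, 29} : Finset (ZMod 32))).filter fun w => c * w ∉ residueSet 32 Φ).card)) ∧ cmTypeRank Φ = 7) ∨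
    ((¬(∀ c ∈ unitResidues 32, ((({1, 15} : Finset (ZMod 32))).filter fun w => c * w ∈ residueSet 32 Φ).card = ((({1, 15} : Finset (ZMod 32))).filter fun w => c * w ∉ residueSet 32 Φ).card) ∧
        ¬(∀ c ∈ unitResidues 32, ((({1, 7, 17, 23} : Finset (ZMod 32))).filter fun w => c * w ∈ residueSet 32 Φ).card = ((({1, 7, 17, 23} : Finset (ZMod 32))).filter fun w => c * w ∉ residueSet 32 Φ).card) ∧
        (∀ c ∈ unitResidues 32, ((({1, 3, 9, 11, 17, 19, 25, 27} : Finset (ZMod 32))).filter fun w => c * w ∈ residueSet 32 Φ).card = ((({1, 3, 9, 11, 17, 19, 25, 27} : Finset (ZMod 32))).filter fun w => c * w ∉ residueSet 32 Φ).card) ∧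
        (∀ c ∈ unitResidues 32, ((({1, 5, 9, 13, 17, 21, 25, 29} : Finset (ZMod 32))).filter fun w => c * w ∈ residueSet 32 Φ).card = ((({1, 5, 9, 13, 17, 21, 25, 29} : Finset (ZMod 32))).filter fun w => c * w ∉ residueSet 32 Φ).card)) ∧ cmTypeRank Φ = 7) := by
  obtain ⟨⟨hu0, h10, hm0, hn0, hc0⟩, ⟨hu1, h11, hm1, hn1, hc1⟩, ⟨hu2, h12, hm2, hn2, hc2⟩, ⟨hu3, h13, hm3, hn3, hc3⟩, ⟨hu4, h14, hm4, hn4, hc4⟩⟩ := subgroups_thirtyTwo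
  obtain ⟨hb0, hb1, hb2, hb3, hb4, hb5, hb6, hb7⟩ := cosetBalanced_reps_thirtyTwo
  obtain ⟨hnb0, hnb1, hnb2, hnb3, hnb4, hnb5, hnb6, hnb7, hnb8, hnb9, hnb10, hnb11, hnb12, hnb13, hnb14, hnb15, hnb16⟩ := not_cosetBalanced_deg_reps_thirtyTwo
  obtain ⟨Ψ, hΨ, hT⟩ := (exists_isAutTransform_thirtyTwo Φ φ₀).2.1 hp hb
  rw [cmTypeRank_eq_of_isAutTransform hT]
  -- balance transports along the family in both directions
  have fwd : ∀ {W : Finset (ZMod 32)}, W ⊆ unitResidues 32 →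
      (∀ c ∈ unitResidues 32, (W.filter fun w => c * w ∈ residueSet 32 Ψ).card = (W.filter fun w => c * w ∉ residueSet 32 Ψ).card) →
      (∀ c ∈ unitResidues 32, (W.filter fun w => c * w ∈ residueSet 32 Φ).card = (W.filter fun w => c * w ∉ residueSet 32 Φ).card) :=
    fun {W} hWu h ↦ cosetBalanced_of_isAutTransform hT hWu h
  have bwd : ∀ {W : Finset (ZMod 32)}, W ⊆ unitResidues 32 →
      ¬(∀ c ∈ unitResidues 32, (W.filter fun w => c * w ∈ residueSet 32 Ψ).card = (W.filter fun w => c * w ∉ residueSet 32 Ψ).card) →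
      ¬(∀ c ∈ unitResidues 32, (W.filter fun w => c * w ∈ residueSet 32 Φ).card = (W.filter fun w => c * w ∉ residueSet 32 Φ).card) :=
    fun {W} hWu h h' ↦ h (cosetBalanced_of_isAutTransform hT.symm hWu h')
  simp only [Finset.mem_insert, Finset.mem_singleton] at hΨ
  rcases hΨ with h | h | h | h | h | h
  · refine Or.inl ?_
    exact ⟨⟨bwd hu0 (by rw [h]; exact hnb0), bwd hu1 (by rw [h]; exact hnb1), fwd hu2 (by rw [h]; exact hb0), bwd hu3 (by rw [h]; exact hnb2)⟩, cmTypeRank_eq_of_residueSet_eq_D1_thirtyTwo Ψ h⟩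
  · refine Or.inr (Or.inl ?_)
    exact ⟨⟨bwd hu0 (by rw [h]; exact hnb3), bwd hu1 (by rw [h]; exact hnb4), bwd hu2 (by rw [h]; exact hnb5), fwd hu3 (by rw [h]; exact hb1)⟩, cmTypeRank_eq_of_residueSet_eq_D2_thirtyTwo Ψ h⟩
  · refine Or.inl ?_
    exact ⟨⟨bwd hu0 (by rw [h]; exact hnb6), bwd hu1 (by rw [h]; exact hnb7), fwd hu2 (by rw [h]; exact hb2), bwd hu3 (by rw [h]; exact hnb8)⟩, cmTypeRank_eq_of_residueSet_eq_D3_thirtyTwo Ψ h⟩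
  · refine Or.inr (Or.inl ?_)
    exact ⟨⟨bwd hu0 (by rw [h]; exact hnb9), bwd hu1 (by rw [h]; exact hnb10), bwd hu2 (by rw [h]; exact hnb11), fwd hu3 (by rw [h]; exact hb3)⟩, cmTypeRank_eq_of_residueSet_eq_D4_thirtyTwo Ψ h⟩
  · refine Or.inr (Or.inr (Or.inl ?_))
    exact ⟨⟨bwd hu0 (by rw [h]; exact hnb12), fwd hu1 (by rw [h]; exact hb4), bwd hu2 (by rw [h]; exact hnb13), bwd hu3 (by rw [h]; exact hnb14)⟩, cmTypeRank_eq_of_residueSet_eq_D5_thirtyTwo Ψ h⟩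
  · refine Or.inr (Or.inr (Or.inr (?_)))
    exact ⟨⟨bwd hu0 (by rw [h]; exact hnb15), bwd hu1 (by rw [h]; exact hnb16), fwd hu2 (by rw [h]; exact hb5), fwd hu3 (by rw [h]; exact hb6)⟩, cmTypeRank_eq_of_residueSet_eq_D6_thirtyTwo Ψ h⟩

/-- **THE RANKS OF THE IMPRIMITIVE TYPES OF `ℚ(ζ₃₂)`: `5`, `3`, `2` according as the residue stabiliser has order `2`, `4`, `8`.**
[cite: Kubota1965, §2 (p. 115)] [cite: KoblitzRohrlich1978, §1 p. 1184] [cite: Shimura1998, §8.2 Prop. 26] -/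
theorem cmTypeRank_of_not_isPrimitive_thirtyTwo (Φ : CMType K) (φ₀ : K →+* ℂ) (hΦ : ¬IsPrimitive (ℂ ≃+* ℂ) Φ.1 φ₀) :
    (((unitResidues 32).filter fun t => ∀ c ∈ unitResidues 32, (c * t ∈ residueSet 32 Φ ↔ c ∈ residueSet 32 Φ)).card = 2 ∧ cmTypeRank Φ = 5) ∨
    (((unitResidues 32).filter fun t => ∀ c ∈ unitResidues 32, (c * t ∈ residueSet 32 Φ ↔ c ∈ residueSet 32 Φ)).card = 4 ∧ cmTypeRank Φ = 3) ∨
    (((unitResidues 32).filter fun t => ∀ c ∈ unitResidues 32, (c * t ∈ residueSet 32 Φ ↔ c ∈ residueSet 32 Φ)).card = 8 ∧ cmTypeRank Φ = 2) := by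
  rcases card_stabilizer_of_not_isPrimitive_thirtyTwo Φ φ₀ hΦ with h2 | h4 | h8
  · refine Or.inl ⟨h2, ?_⟩
    obtain ⟨Ψ, hΨ, hT⟩ := (exists_isAutTransform_thirtyTwo Φ φ₀).2.2 hΦ
    obtain ⟨⟨hs0, hi0⟩, ⟨hs1, hi1⟩, ⟨hs2, hi2⟩, ⟨hs3, hi3⟩, ⟨hs4, hi4⟩, ⟨hs5, hi5⟩⟩ := stabilizer_reps_thirtyTwo
    have hstab := filter_stabilizer_eq_of_isAutTransform_thirtyTwo hT
    rw [cmTypeRank_eq_of_isAutTransform hT]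
    rw [hstab] at h2
    simp only [Finset.mem_insert, Finset.mem_singleton] at hΨ
    rcases hΨ with h | h | h | h | h | h
    · exact cmTypeRank_eq_of_residueSet_eq_I1_thirtyTwo Ψ h
    · exact cmTypeRank_eq_of_residueSet_eq_I2_thirtyTwo Ψ h
    · exact cmTypeRank_eq_of_residueSet_eq_I3_thirtyTwo Ψ h
    · exact absurd h2 (by rw [h, hs3]; decide +kernel)
    · exact absurd h2 (by rw [h, hs4]; decide +kernel)
    · exact absurd h2 (by rw [h, hs5]; decide +kernel)
  · exact Or.inr (Or.inl ⟨h4, cmTypeRank_eq_three_of_card_stabilizer_eq_four_thirtyTwo Φ h4⟩)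
  · exact Or.inr (Or.inr ⟨h8, cmTypeRank_eq_two_of_card_stabilizer_eq_eight_thirtyTwo Φ h8⟩)

/-- **`Rank ∈ {9, 8, 7, 5, 3, 2}` for every CM type of `ℚ(ζ₃₂)`.** [cite: Gordon1999HodgeAVSurvey, §9.4.1–9.4.3] [cite: Kubota1965, §2] -/
theorem cmTypeRank_mem_thirtyTwo (Φ : CMType K) : cmTypeRank Φ = 9 ∨ cmTypeRank Φ = 8 ∨ cmTypeRank Φ = 7 ∨ cmTypeRank Φ = 5 ∨ cmTypeRank Φ = 3 ∨ cmTypeRank Φ = 2 := by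
  obtain ⟨φ₀⟩ : Nonempty (K →+* ℂ) := inferInstance
  by_cases hb : ((∀ c ∈ unitResidues 32, ((({1, 15} : Finset (ZMod 32))).filter fun w => c * w ∈ residueSet 32 Φ).card = ((({1, 15} : Finset (ZMod 32))).filter fun w => c * w ∉ residueSet 32 Φ).card) ∨
      (∀ c ∈ unitResidues 32, ((({1, 7, 17, 23} : Finset (ZMod 32))).filter fun w => c * w ∈ residueSet 32 Φ).card = ((({1, 7, 17, 23} : Finset (ZMod 32))).filter fun w => c * w ∉ residueSet 32 Φ).card) ∨
      (∀ c ∈ unitResidues 32, ((({1, 3, 9, 11, 17, 19, 25, 27} : Finset (ZMod 32))).filter fun w => c * w ∈ residueSet 32 Φ).card = ((({1, 3, 9, 11, 17, 19, 25, 27} : Finset (ZMod 32))).filter fun w => c * w ∉ residueSet 32 Φ).card) ∨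
      (∀ c ∈ unitResidues 32, ((({1, 5, 9, 13, 17, 21, 25, 29} : Finset (ZMod 32))).filter fun w => c * w ∈ residueSet 32 Φ).card = ((({1, 5, 9, 13, 17, 21, 25, 29} : Finset (ZMod 32))).filter fun w => c * w ∉ residueSet 32 Φ).card))
  · by_cases hp : IsPrimitive (ℂ ≃+* ℂ) Φ.1 φ₀
    · rcases cmTypeRank_of_isPrimitive_of_cosetBalanced_thirtyTwo Φ φ₀ hp hb with ⟨-, h⟩ | ⟨-, h⟩ | ⟨-, h⟩ | ⟨-, h⟩ <;> rw [h] <;> decide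
    · rcases cmTypeRank_of_not_isPrimitive_thirtyTwo Φ φ₀ hp with ⟨-, h⟩ | ⟨-, h⟩ | ⟨-, h⟩ <;> rw [h] <;> decide
  · have h := cmTypeRank_eq_nine_of_not_cosetBalanced_thirtyTwo Φ hb
    rw [h]; decide

/-- **Primitive ⟺ `Rank ≥ 7`**, for the CM types of `ℚ(ζ₃₂)` (primitive ranks `9, 8, 7`, imprimitive ranks `5, 3, 2`).
[cite: Shimura1998, §8.2 Prop. 26] [cite: Kubota1965, §2] -/
theorem isPrimitive_iff_seven_le_cmTypeRank_thirtyTwo (Φ : CMType K) (φ₀ : K →+* ℂ) : IsPrimitive (ℂ ≃+* ℂ) Φ.1 φ₀ ↔ 7 ≤ cmTypeRank Φ := by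
  constructor
  · intro hp
    by_cases hb : ((∀ c ∈ unitResidues 32, ((({1, 15} : Finset (ZMod 32))).filter fun w => c * w ∈ residueSet 32 Φ).card = ((({1, 15} : Finset (ZMod 32))).filter fun w => c * w ∉ residueSet 32 Φ).card) ∨
      (∀ c ∈ unitResidues 32, ((({1, 7, 17, 23} : Finset (ZMod 32))).filter fun w => c * w ∈ residueSet 32 Φ).card = ((({1, 7, 17, 23} : Finset (ZMod 32))).filter fun w => c * w ∉ residueSet 32 Φ).card) ∨
      (∀ c ∈ unitResidues 32, ((({1, 3, 9, 11, 17, 19, 25, 27} : Finset (ZMod 32))).filter fun w => c * w ∈ residueSet 32 Φ).card = ((({1, 3, 9, 11, 17, 19, 25, 27} : Finset (ZMod 32))).filter fun w => c * w ∉ residueSet 32 Φ).card) ∨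
      (∀ c ∈ unitResidues 32, ((({1, 5, 9, 13, 17, 21, 25, 29} : Finset (ZMod 32))).filter fun w => c * w ∈ residueSet 32 Φ).card = ((({1, 5, 9, 13, 17, 21, 25, 29} : Finset (ZMod 32))).filter fun w => c * w ∉ residueSet 32 Φ).card))
    · rcases cmTypeRank_of_isPrimitive_of_cosetBalanced_thirtyTwo Φ φ₀ hp hb with ⟨-, h⟩ | ⟨-, h⟩ | ⟨-, h⟩ | ⟨-, h⟩ <;> omega
    · have h := cmTypeRank_eq_nine_of_not_cosetBalanced_thirtyTwo Φ hb
      omega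
  · intro h7
    by_contra hp
    rcases cmTypeRank_of_not_isPrimitive_thirtyTwo Φ φ₀ hp with ⟨-, h⟩ | ⟨-, h⟩ | ⟨-, h⟩ <;> omega

end Types

/-! ### §2 Abelian varieties with complex multiplication by `ℚ(ζ₃₂)` -/

section Varieties

variable {K : Type} [Field K] [NumberField K]
  {A : AbelianVariety ℂ} {ι : 𝓞 K →+* End A} {θ : K →+* Module.End ℂ (complexBetti A.X 1)}

/-- `dim A = 8` for a realisation of a CM type of `ℚ(ζ₃₂)`. [cite: Shimura1998, §6.2 Theorem 3] -/
theorem dim_eq_eight_of_isCMTypeRealisation_thirtyTwo (hK : IsCyclotomicExtension {32} ℚ K) {Φ : CMType K} (hA : IsCMTypeRealisation Φ A ι θ) :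
    A.dim = 8 := by
  have h := Literature.AlgebraicGeometry.Motives.schemeDim_eq_holds hA.1
  rw [finrank_eq_sixteen₈ K] at h
  exact h

/-- **`Bᵐ(Aⁿ) ⊗ ℂ = Dᵐ(Aⁿ) ⊗ ℂ` FOR ALL `n, m`, FOR EVERY TYPE OF `ℚ(ζ₃₂)` THAT IS NOT A PRIMITIVE COSET-BALANCED ONE** (`160` of the `256` types:
nondegenerate, or imprimitive and then induced from a NONDEGENERATE type of an octic, quartic or quadratic CM subfield).
[cite: Gordon1999HodgeAVSurvey, Thm. 6.4 and §9.3] [cite: Kubota1965, §2] -/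
theorem hodgeClassSpan_pow_eq_divisorClassesSpan_of_thirtyTwo (hK : IsCyclotomicExtension {32} ℚ K) (Φ : CMType K) (φ₀ : K →+* ℂ)
    (h : IsPrimitive (ℂ ≃+* ℂ) Φ.1 φ₀ →
      ¬((∀ c ∈ unitResidues 32, ((({1, 15} : Finset (ZMod 32))).filter fun w => c * w ∈ residueSet 32 Φ).card = ((({1, 15} : Finset (ZMod 32))).filter fun w => c * w ∉ residueSet 32 Φ).card) ∨
      (∀ c ∈ unitResidues 32, ((({1, 7, 17, 23} : Finset (ZMod 32))).filter fun w => c * w ∈ residueSet 32 Φ).card = ((({1, 7, 17, 23} : Finset (ZMod 32))).filter fun w => c * w ∉ residueSet 32 Φ).card) ∨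
      (∀ c ∈ unitResidues 32, ((({1, 3, 9, 11, 17, 19, 25, 27} : Finset (ZMod 32))).filter fun w => c * w ∈ residueSet 32 Φ).card = ((({1, 3, 9, 11, 17, 19, 25, 27} : Finset (ZMod 32))).filter fun w => c * w ∉ residueSet 32 Φ).card) ∨
      (∀ c ∈ unitResidues 32, ((({1, 5, 9, 13, 17, 21, 25, 29} : Finset (ZMod 32))).filter fun w => c * w ∈ residueSet 32 Φ).card = ((({1, 5, 9, 13, 17, 21, 25, 29} : Finset (ZMod 32))).filter fun w => c * w ∉ residueSet 32 Φ).card)))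
    (hA : IsCMTypeRealisation Φ A ι θ) (n m : ℕ) :
    hodgeClassSpan (⨁ fun _ : Fin n => A).dim (⨁ fun _ : Fin n => A).X m =
      divisorClassesSpan (⨁ fun _ : Fin n => A).X (⨁ fun _ : Fin n => A).dim m := by
  haveI := isCMField₈ K
  by_cases hΦ : IsPrimitive (ℂ ≃+* ℂ) Φ.1 φ₀
  · exact ((isNondegenerate_iff_not_cosetBalanced_thirtyTwo hK Φ).2 (h hΦ)).hodgeClassSpan_pow_eq_divisorClassesSpan hA n m
  · rcases cmTypeRank_of_not_isPrimitive_thirtyTwo Φ φ₀ hΦ with ⟨hs, hr⟩ | ⟨hs, hr⟩ | ⟨hs, hr⟩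
    · exact hodgeClassSpan_pow_eq_divisorClassesSpan_of_card_stabilizer_mul_eq (N := 32) (by norm_num) Φ (k := 4)
        (by rw [hs]; decide +kernel) hr hA n m
    · exact hodgeClassSpan_pow_eq_divisorClassesSpan_of_card_stabilizer_mul_eq (N := 32) (by norm_num) Φ (k := 2)
        (by rw [hs]; decide +kernel) hr hA n m
    · exact hodgeClassSpan_pow_eq_divisorClassesSpan_of_card_stabilizer_mul_eq (N := 32) (by norm_num) Φ (k := 1)
        (by rw [hs]; decide +kernel) hr hA n m

/-- `Bᵐ ⊗ ℂ = Dᵐ ⊗ ℂ` for all `m` on an abelian variety gives the Hodge conjecture for it. [cite: Gordon1999HodgeAVSurvey, §9.3] -/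
private theorem hodgeConjectureFor_of_forall_hodgeClassSpan_eq₈ (B : AbelianVariety ℂ)
    (h : ∀ m : ℕ, hodgeClassSpan B.dim B.X m = divisorClassesSpan B.X B.dim m) : HodgeConjectureFor B.dim B.X :=
  ⟨Literature.AlgebraicGeometry.HodgeTheory.nonempty_hodgeModel_holds
      (Literature.AlgebraicGeometry.Motives.AbelianVariety.isSmoothProjective_holds (A := B)),
    fun m _ hc hmm ↦ Literature.AlgebraicGeometry.HodgeTheory.AbelianVariety.divisorClassesSpan_le_algebraicClasses B
      (fun b hb hb' ↦ Literature.AlgebraicGeometry.HodgeTheory.lefschetzOneOne_rational_holds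
        (Literature.AlgebraicGeometry.Motives.AbelianVariety.isSmoothProjective_holds (A := B)) b hb hb') m
      ((h m) ▸ Submodule.subset_span ⟨hc, hmm⟩)⟩

/-- **THE HODGE CONJECTURE FOR EVERY POWER OF EVERY ABELIAN VARIETY WITH COMPLEX MULTIPLICATION BY `ℚ(ζ₃₂)` WHOSE TYPE IS NOT A PRIMITIVE
COSET-BALANCED ONE** (`160` of the `256` types), unconditionally. [cite: Gordon1999HodgeAVSurvey, Thm. 6.4 and §9.3] -/
theorem hodgeConjectureFor_pow_of_thirtyTwo (hK : IsCyclotomicExtension {32} ℚ K) (Φ : CMType K) (φ₀ : K →+* ℂ)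
    (h : IsPrimitive (ℂ ≃+* ℂ) Φ.1 φ₀ →
      ¬((∀ c ∈ unitResidues 32, ((({1, 15} : Finset (ZMod 32))).filter fun w => c * w ∈ residueSet 32 Φ).card = ((({1, 15} : Finset (ZMod 32))).filter fun w => c * w ∉ residueSet 32 Φ).card) ∨
      (∀ c ∈ unitResidues 32, ((({1, 7, 17, 23} : Finset (ZMod 32))).filter fun w => c * w ∈ residueSet 32 Φ).card = ((({1, 7, 17, 23} : Finset (ZMod 32))).filter fun w => c * w ∉ residueSet 32 Φ).card) ∨
      (∀ c ∈ unitResidues 32, ((({1, 3, 9, 11, 17, 19, 25, 27} : Finset (ZMod 32))).filter fun w => c * w ∈ residueSet 32 Φ).card = ((({1, 3, 9, 11, 17, 19, 25, 27} : Finset (ZMod 32))).filter fun w => c * w ∉ residueSet 32 Φ).card) ∨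
      (∀ c ∈ unitResidues 32, ((({1, 5, 9, 13, 17, 21, 25, 29} : Finset (ZMod 32))).filter fun w => c * w ∈ residueSet 32 Φ).card = ((({1, 5, 9, 13, 17, 21, 25, 29} : Finset (ZMod 32))).filter fun w => c * w ∉ residueSet 32 Φ).card)))
    (hA : IsCMTypeRealisation Φ A ι θ) (n : ℕ) :
    HodgeConjectureFor (⨁ fun _ : Fin n => A).dim (⨁ fun _ : Fin n => A).X :=
  hodgeConjectureFor_of_forall_hodgeClassSpan_eq₈ _ (fun m ↦ hodgeClassSpan_pow_eq_divisorClassesSpan_of_thirtyTwo hK Φ φ₀ h hA n m)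

/-- **EVERY REALISATION OF A PRIMITIVE TYPE OF `ℚ(ζ₃₂)` COSET-BALANCED FOR A MAXIMAL `(−1)`-FREE SUBGROUP OF ORDER `8` IS A SIMPLE ABELIAN `8`-FOLD
CARRYING RATIONAL `(4,4)`-CLASSES OUTSIDE `D⁴(A) ⊗ ℂ`** — the Weil classes of `(A, k)`, `k` the imaginary quadratic fixed field
(ℚ(√−2), ℚ(i)), acting with multiplicities `(4,4)`; `dim B⁴ − dim D⁴ ≥ 2`.
[cite: Gordon1999HodgeAVSurvey, 5.13 (ii) and 9.2.2] [cite: vanGeemen1994HodgeAV, Thm. 4.5 and 4.7] [cite: Pohlmann1968, §3] [cite: Shimura1998, §8.2 Prop. 26] -/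
theorem exists_exceptional_four_of_cosetBalanced_thirtyTwo (hK : IsCyclotomicExtension {32} ℚ K) (Φ : CMType K) (φ₀ : K →+* ℂ)
    (hΦ : IsPrimitive (ℂ ≃+* ℂ) Φ.1 φ₀)
    (hbal : (∀ c ∈ unitResidues 32, ((({1, 3, 9, 11, 17, 19, 25, 27} : Finset (ZMod 32))).filter fun w => c * w ∈ residueSet 32 Φ).card = ((({1, 3, 9, 11, 17, 19, 25, 27} : Finset (ZMod 32))).filter fun w => c * w ∉ residueSet 32 Φ).card) ∨
      (∀ c ∈ unitResidues 32, ((({1, 5, 9, 13, 17, 21, 25, 29} : Finset (ZMod 32))).filter fun w => c * w ∈ residueSet 32 Φ).card = ((({1, 5, 9, 13, 17, 21, 25, 29} : Finset (ZMod 32))).filter fun w => c * w ∉ residueSet 32 Φ).card))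
    (hA : IsCMTypeRealisation Φ A ι θ) :
    A.IsSimple ∧ A.dim = 8 ∧
      (∃ c : complexBetti A.X (2 * 4), IsRationalClass c ∧ IsOfHodgeType 8 A.X (2 * 4) 4 4 c ∧ c ∉ divisorClassesSpan A.X 8 4) ∧
      2 ≤ Module.finrank ℂ ↥(hodgeClassSpan 8 A.X 4) - Module.finrank ℂ ↥(divisorClassesSpan A.X 8 4) := by
  obtain ⟨⟨hu0, h10, hm0, hn0, hc0⟩, ⟨hu1, h11, hm1, hn1, hc1⟩, ⟨hu2, h12, hm2, hn2, hc2⟩, ⟨hu3, h13, hm3, hn3, hc3⟩, ⟨hu4, h14, hm4, hn4, hc4⟩⟩ := subgroups_thirtyTwo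
  have hprim : HasTrivialStabilizer 32 (residueSet 32 Φ) := (isPrimitive_iff_hasTrivialStabilizer 32 Φ φ₀).1 hΦ
  have htot : Nat.totient 32 / 2 = 8 := by decide +kernel
  refine ⟨isSimple_of_isCMTypeRealisation_of_isPrimitive hA φ₀ hΦ, dim_eq_eight_of_isCMTypeRealisation_thirtyTwo hK hA, ?_, ?_⟩
  · rcases hbal with hb | hb
    · obtain ⟨c, hcQ, hcH, hcD⟩ := exists_exceptional_of_cosetBalanced hu2 h12 hm2 hn2 hb hprim hc2 hA
      rw [htot] at hcH hcD
      exact ⟨c, hcQ, hcH, hcD⟩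
    · obtain ⟨c, hcQ, hcH, hcD⟩ := exists_exceptional_of_cosetBalanced hu3 h13 hm3 hn3 hb hprim hc3 hA
      rw [htot] at hcH hcD
      exact ⟨c, hcQ, hcH, hcD⟩
  · rcases hbal with hb | hb
    · have h := two_le_finrank_hodgeClassSpan_sub_finrank_divisorClassesSpan_of_cosetBalanced hu2 h12 hm2 hn2 hb hprim hc2 hA
      rwa [htot] at h
    · have h := two_le_finrank_hodgeClassSpan_sub_finrank_divisorClassesSpan_of_cosetBalanced hu3 h13 hm3 hn3 hb hprim hc3 hA
      rwa [htot] at h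

/-- **EVERY REALISATION OF A PRIMITIVE TYPE OF `ℚ(ζ₃₂)` COSET-BALANCED FOR A `(−1)`-FREE SUBGROUP OF ORDER `4` IS A SIMPLE ABELIAN `8`-FOLD CARRYING
RATIONAL `(2,2)`-CLASSES OUTSIDE `D²(A) ⊗ ℂ`** — the generalised Weil classes of `(A, k)` for the quartic CM fixed field `k` of `W`, in `H⁴`;
`dim B² − dim D² ≥ 2`. [cite: Gordon1999HodgeAVSurvey, 5.13 (ii), 9.2.2 and 9.4.3] [cite: vanGeemen1994HodgeAV, Thm. 4.5 and 4.7] [cite: Pohlmann1968, §3] -/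
theorem exists_exceptional_two_of_cosetBalanced_thirtyTwo (hK : IsCyclotomicExtension {32} ℚ K) (Φ : CMType K) (φ₀ : K →+* ℂ)
    (hΦ : IsPrimitive (ℂ ≃+* ℂ) Φ.1 φ₀)
    (hbal : (∀ c ∈ unitResidues 32, ((({1, 7, 17, 23} : Finset (ZMod 32))).filter fun w => c * w ∈ residueSet 32 Φ).card = ((({1, 7, 17, 23} : Finset (ZMod 32))).filter fun w => c * w ∉ residueSet 32 Φ).card) ∨
      (∀ c ∈ unitResidues 32, ((({1, 9, 17, 25} : Finset (ZMod 32))).filter fun w => c * w ∈ residueSet 32 Φ).card = ((({1, 9, 17, 25} : Finset (ZMod 32))).filter fun w => c * w ∉ residueSet 32 Φ).card))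
    (hA : IsCMTypeRealisation Φ A ι θ) :
    A.IsSimple ∧ A.dim = 8 ∧
      (∃ c : complexBetti A.X (2 * 2), IsRationalClass c ∧ IsOfHodgeType 8 A.X (2 * 2) 2 2 c ∧ c ∉ divisorClassesSpan A.X 8 2) ∧
      2 ≤ Module.finrank ℂ ↥(hodgeClassSpan 8 A.X 2) - Module.finrank ℂ ↥(divisorClassesSpan A.X 8 2) := by
  obtain ⟨⟨hu0, h10, hm0, hn0, hc0⟩, ⟨hu1, h11, hm1, hn1, hc1⟩, ⟨hu2, h12, hm2, hn2, hc2⟩, ⟨hu3, h13, hm3, hn3, hc3⟩, ⟨hu4, h14, hm4, hn4, hc4⟩⟩ := subgroups_thirtyTwo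
  have hprim : HasTrivialStabilizer 32 (residueSet 32 Φ) := (isPrimitive_iff_hasTrivialStabilizer 32 Φ φ₀).1 hΦ
  have htot : Nat.totient 32 / 2 = 8 := by decide +kernel
  refine ⟨isSimple_of_isCMTypeRealisation_of_isPrimitive hA φ₀ hΦ, dim_eq_eight_of_isCMTypeRealisation_thirtyTwo hK hA, ?_, ?_⟩
  · rcases hbal with hb | hb
    · obtain ⟨c, hcQ, hcH, hcD⟩ := exists_exceptional_of_cosetBalanced hu1 h11 hm1 hn1 hb hprim hc1 hA
      rw [htot] at hcH hcD
      exact ⟨c, hcQ, hcH, hcD⟩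
    · obtain ⟨c, hcQ, hcH, hcD⟩ := exists_exceptional_of_cosetBalanced hu4 h14 hm4 hn4 hb hprim hc4 hA
      rw [htot] at hcH hcD
      exact ⟨c, hcQ, hcH, hcD⟩
  · rcases hbal with hb | hb
    · have h := two_le_finrank_hodgeClassSpan_sub_finrank_divisorClassesSpan_of_cosetBalanced hu1 h11 hm1 hn1 hb hprim hc1 hA
      rwa [htot] at h
    · have h := two_le_finrank_hodgeClassSpan_sub_finrank_divisorClassesSpan_of_cosetBalanced hu4 h14 hm4 hn4 hb hprim hc4 hA
      rwa [htot] at h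

/-- **`B⁴ ≠ D⁴` or `B² ≠ D²` for every realisation of a primitive coset-balanced type of `ℚ(ζ₃₂)`** (balanced for an order-`8` maximal subgroup ⟹
`B⁴(A) ⊗ ℂ ≠ D⁴(A) ⊗ ℂ`; otherwise it is balanced for a `(−1)`-free subgroup of order `4` and `B²(A) ⊗ ℂ ≠ D²(A) ⊗ ℂ`).
[cite: Gordon1999HodgeAVSurvey, 5.13 (ii) and 9.4.3] -/
theorem hodgeClassSpan_ne_of_cosetBalanced_thirtyTwo (hK : IsCyclotomicExtension {32} ℚ K) (Φ : CMType K) (φ₀ : K →+* ℂ)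
    (hΦ : IsPrimitive (ℂ ≃+* ℂ) Φ.1 φ₀)
    (hb : ((∀ c ∈ unitResidues 32, ((({1, 15} : Finset (ZMod 32))).filter fun w => c * w ∈ residueSet 32 Φ).card = ((({1, 15} : Finset (ZMod 32))).filter fun w => c * w ∉ residueSet 32 Φ).card) ∨
      (∀ c ∈ unitResidues 32, ((({1, 7, 17, 23} : Finset (ZMod 32))).filter fun w => c * w ∈ residueSet 32 Φ).card = ((({1, 7, 17, 23} : Finset (ZMod 32))).filter fun w => c * w ∉ residueSet 32 Φ).card) ∨
      (∀ c ∈ unitResidues 32, ((({1, 3, 9, 11, 17, 19, 25, 27} : Finset (ZMod 32))).filter fun w => c * w ∈ residueSet 32 Φ).card = ((({1, 3, 9, 11, 17, 19, 25, 27} : Finset (ZMod 32))).filter fun w => c * w ∉ residueSet 32 Φ).card) ∨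
      (∀ c ∈ unitResidues 32, ((({1, 5, 9, 13, 17, 21, 25, 29} : Finset (ZMod 32))).filter fun w => c * w ∈ residueSet 32 Φ).card = ((({1, 5, 9, 13, 17, 21, 25, 29} : Finset (ZMod 32))).filter fun w => c * w ∉ residueSet 32 Φ).card)))
    (hA : IsCMTypeRealisation Φ A ι θ) :
    (((∀ c ∈ unitResidues 32, ((({1, 3, 9, 11, 17, 19, 25, 27} : Finset (ZMod 32))).filter fun w => c * w ∈ residueSet 32 Φ).card = ((({1, 3, 9, 11, 17, 19, 25, 27} : Finset (ZMod 32))).filter fun w => c * w ∉ residueSet 32 Φ).card) ∨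
      (∀ c ∈ unitResidues 32, ((({1, 5, 9, 13, 17, 21, 25, 29} : Finset (ZMod 32))).filter fun w => c * w ∈ residueSet 32 Φ).card = ((({1, 5, 9, 13, 17, 21, 25, 29} : Finset (ZMod 32))).filter fun w => c * w ∉ residueSet 32 Φ).card)) ∧
      hodgeClassSpan 8 A.X 4 ≠ divisorClassesSpan A.X 8 4) ∨
    (((∀ c ∈ unitResidues 32, ((({1, 7, 17, 23} : Finset (ZMod 32))).filter fun w => c * w ∈ residueSet 32 Φ).card = ((({1, 7, 17, 23} : Finset (ZMod 32))).filter fun w => c * w ∉ residueSet 32 Φ).card) ∨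
      (∀ c ∈ unitResidues 32, ((({1, 9, 17, 25} : Finset (ZMod 32))).filter fun w => c * w ∈ residueSet 32 Φ).card = ((({1, 9, 17, 25} : Finset (ZMod 32))).filter fun w => c * w ∉ residueSet 32 Φ).card)) ∧
      hodgeClassSpan 8 A.X 2 ≠ divisorClassesSpan A.X 8 2) := by
  have h4 : ((∀ c ∈ unitResidues 32, ((({1, 3, 9, 11, 17, 19, 25, 27} : Finset (ZMod 32))).filter fun w => c * w ∈ residueSet 32 Φ).card = ((({1, 3, 9, 11, 17, 19, 25, 27} : Finset (ZMod 32))).filter fun w => c * w ∉ residueSet 32 Φ).card) ∨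
      (∀ c ∈ unitResidues 32, ((({1, 5, 9, 13, 17, 21, 25, 29} : Finset (ZMod 32))).filter fun w => c * w ∈ residueSet 32 Φ).card = ((({1, 5, 9, 13, 17, 21, 25, 29} : Finset (ZMod 32))).filter fun w => c * w ∉ residueSet 32 Φ).card)) →
      hodgeClassSpan 8 A.X 4 ≠ divisorClassesSpan A.X 8 4 := fun hb8 h ↦ by
    obtain ⟨-, -, ⟨c, hcQ, hcH, hcD⟩, -⟩ := exists_exceptional_four_of_cosetBalanced_thirtyTwo hK Φ φ₀ hΦ hb8 hA
    exact hcD (h ▸ Submodule.subset_span ⟨hcQ, hcH⟩)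
  have h2 : ((∀ c ∈ unitResidues 32, ((({1, 7, 17, 23} : Finset (ZMod 32))).filter fun w => c * w ∈ residueSet 32 Φ).card = ((({1, 7, 17, 23} : Finset (ZMod 32))).filter fun w => c * w ∉ residueSet 32 Φ).card) ∨
      (∀ c ∈ unitResidues 32, ((({1, 9, 17, 25} : Finset (ZMod 32))).filter fun w => c * w ∈ residueSet 32 Φ).card = ((({1, 9, 17, 25} : Finset (ZMod 32))).filter fun w => c * w ∉ residueSet 32 Φ).card)) →
      hodgeClassSpan 8 A.X 2 ≠ divisorClassesSpan A.X 8 2 := fun hb4 h ↦ by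
    obtain ⟨-, -, ⟨c, hcQ, hcH, hcD⟩, -⟩ := exists_exceptional_two_of_cosetBalanced_thirtyTwo hK Φ φ₀ hΦ hb4 hA
    exact hcD (h ▸ Submodule.subset_span ⟨hcQ, hcH⟩)
  rcases cmTypeRank_of_isPrimitive_of_cosetBalanced_thirtyTwo Φ φ₀ hΦ hb with ⟨hpr, -⟩ | ⟨hpr, -⟩ | ⟨hpr, -⟩ | ⟨hpr, -⟩
  · exact Or.inl ⟨Or.inl hpr.2.2.1, h4 (Or.inl hpr.2.2.1)⟩
  · exact Or.inl ⟨Or.inr (hpr.2.2.2), h4 (Or.inr (hpr.2.2.2))⟩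
  · exact Or.inr ⟨Or.inl hpr.2.1, h2 (Or.inl hpr.2.1)⟩
  · exact Or.inl ⟨Or.inl hpr.2.2.1, h4 (Or.inl hpr.2.2.1)⟩

/-- **THE DICHOTOMY FOR THE CM ABELIAN VARIETIES OF `ℚ(ζ₃₂)`**: for every abelian variety `A` with complex multiplication by `ℚ(ζ₃₂)` (any type):
EITHER `B•(Aⁿ) ⊗ ℂ = D•(Aⁿ) ⊗ ℂ` for all `n` and the Hodge conjecture holds for every power of `A` (`160` types), OR the type is primitive and
coset-balanced (`96` types) and `A` is a simple `8`-fold with `B⁴(A) ⊗ ℂ ≠ D⁴(A) ⊗ ℂ` or `B²(A) ⊗ ℂ ≠ D²(A) ⊗ ℂ`.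
[cite: Gordon1999HodgeAVSurvey, Thm. 6.4, §9.3, 5.13 (ii), §9.4] -/
theorem hodgeConjectureFor_pow_or_exceptional_thirtyTwo (hK : IsCyclotomicExtension {32} ℚ K) (Φ : CMType K) (φ₀ : K →+* ℂ)
    (hA : IsCMTypeRealisation Φ A ι θ) :
    ((∀ n m : ℕ, hodgeClassSpan (⨁ fun _ : Fin n => A).dim (⨁ fun _ : Fin n => A).X m =
        divisorClassesSpan (⨁ fun _ : Fin n => A).X (⨁ fun _ : Fin n => A).dim m) ∧
      ∀ n : ℕ, HodgeConjectureFor (⨁ fun _ : Fin n => A).dim (⨁ fun _ : Fin n => A).X) ∨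
    (IsPrimitive (ℂ ≃+* ℂ) Φ.1 φ₀ ∧
      ((∀ c ∈ unitResidues 32, ((({1, 15} : Finset (ZMod 32))).filter fun w => c * w ∈ residueSet 32 Φ).card = ((({1, 15} : Finset (ZMod 32))).filter fun w => c * w ∉ residueSet 32 Φ).card) ∨
      (∀ c ∈ unitResidues 32, ((({1, 7, 17, 23} : Finset (ZMod 32))).filter fun w => c * w ∈ residueSet 32 Φ).card = ((({1, 7, 17, 23} : Finset (ZMod 32))).filter fun w => c * w ∉ residueSet 32 Φ).card) ∨
      (∀ c ∈ unitResidues 32, ((({1, 3, 9, 11, 17, 19, 25, 27} : Finset (ZMod 32))).filter fun w => c * w ∈ residueSet 32 Φ).card = ((({1, 3, 9, 11, 17, 19, 25, 27} : Finset (ZMod 32))).filter fun w => c * w ∉ residueSet 32 Φ).card) ∨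
      (∀ c ∈ unitResidues 32, ((({1, 5, 9, 13, 17, 21, 25, 29} : Finset (ZMod 32))).filter fun w => c * w ∈ residueSet 32 Φ).card = ((({1, 5, 9, 13, 17, 21, 25, 29} : Finset (ZMod 32))).filter fun w => c * w ∉ residueSet 32 Φ).card)) ∧
      A.IsSimple ∧ A.dim = 8 ∧
      (hodgeClassSpan 8 A.X 4 ≠ divisorClassesSpan A.X 8 4 ∨ hodgeClassSpan 8 A.X 2 ≠ divisorClassesSpan A.X 8 2)) := by
  by_cases h : IsPrimitive (ℂ ≃+* ℂ) Φ.1 φ₀ ∧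
      ((∀ c ∈ unitResidues 32, ((({1, 15} : Finset (ZMod 32))).filter fun w => c * w ∈ residueSet 32 Φ).card = ((({1, 15} : Finset (ZMod 32))).filter fun w => c * w ∉ residueSet 32 Φ).card) ∨
      (∀ c ∈ unitResidues 32, ((({1, 7, 17, 23} : Finset (ZMod 32))).filter fun w => c * w ∈ residueSet 32 Φ).card = ((({1, 7, 17, 23} : Finset (ZMod 32))).filter fun w => c * w ∉ residueSet 32 Φ).card) ∨
      (∀ c ∈ unitResidues 32, ((({1, 3, 9, 11, 17, 19, 25, 27} : Finset (ZMod 32))).filter fun w => c * w ∈ residueSet 32 Φ).card = ((({1, 3, 9, 11, 17, 19, 25, 27} : Finset (ZMod 32))).filter fun w => c * w ∉ residueSet 32 Φ).card) ∨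
      (∀ c ∈ unitResidues 32, ((({1, 5, 9, 13, 17, 21, 25, 29} : Finset (ZMod 32))).filter fun w => c * w ∈ residueSet 32 Φ).card = ((({1, 5, 9, 13, 17, 21, 25, 29} : Finset (ZMod 32))).filter fun w => c * w ∉ residueSet 32 Φ).card))
  · refine Or.inr ⟨h.1, h.2, isSimple_of_isCMTypeRealisation_of_isPrimitive hA φ₀ h.1, dim_eq_eight_of_isCMTypeRealisation_thirtyTwo hK hA, ?_⟩
    rcases hodgeClassSpan_ne_of_cosetBalanced_thirtyTwo hK Φ φ₀ h.1 h.2 hA with ⟨-, h4⟩ | ⟨-, h2⟩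
    · exact Or.inl h4
    · exact Or.inr h2
  · have h' : IsPrimitive (ℂ ≃+* ℂ) Φ.1 φ₀ →
        ¬((∀ c ∈ unitResidues 32, ((({1, 15} : Finset (ZMod 32))).filter fun w => c * w ∈ residueSet 32 Φ).card = ((({1, 15} : Finset (ZMod 32))).filter fun w => c * w ∉ residueSet 32 Φ).card) ∨
      (∀ c ∈ unitResidues 32, ((({1, 7, 17, 23} : Finset (ZMod 32))).filter fun w => c * w ∈ residueSet 32 Φ).card = ((({1, 7, 17, 23} : Finset (ZMod 32))).filter fun w => c * w ∉ residueSet 32 Φ).card) ∨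
      (∀ c ∈ unitResidues 32, ((({1, 3, 9, 11, 17, 19, 25, 27} : Finset (ZMod 32))).filter fun w => c * w ∈ residueSet 32 Φ).card = ((({1, 3, 9, 11, 17, 19, 25, 27} : Finset (ZMod 32))).filter fun w => c * w ∉ residueSet 32 Φ).card) ∨
      (∀ c ∈ unitResidues 32, ((({1, 5, 9, 13, 17, 21, 25, 29} : Finset (ZMod 32))).filter fun w => c * w ∈ residueSet 32 Φ).card = ((({1, 5, 9, 13, 17, 21, 25, 29} : Finset (ZMod 32))).filter fun w => c * w ∉ residueSet 32 Φ).card)) := fun hp hb ↦ h ⟨hp, hb⟩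
    exact Or.inl ⟨fun n m ↦ hodgeClassSpan_pow_eq_divisorClassesSpan_of_thirtyTwo hK Φ φ₀ h' hA n m,
      fun n ↦ hodgeConjectureFor_pow_of_thirtyTwo hK Φ φ₀ h' hA n⟩

variable (K) in
/-- **NON-VACUITY (Shimura §6.2 Thm. 3, tree `exists_isCMTypeRealisation`): there ARE simple abelian `8`-FOLDS with complex multiplication by
`𝓞_{ℚ(ζ₃₂)}` of primitive coset-balanced types — one with `B⁴ ≠ D⁴` (residue set `{1, 3, 5, 7, 9, 13, 17, 21}`), one with `B² ≠ D²`
(residue set `{1, 3, 5, 9, 11, 13, 17, 25}`) — and one of a nondegenerate type, all of whose powers satisfy the Hodge conjecture.**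
[cite: Shimura1998, §6.2 Thm. 3] [cite: Gordon1999HodgeAVSurvey, §9.4.2] -/
theorem exists_isSimple_exceptional_thirtyTwo [hK : IsCyclotomicExtension {32} ℚ K] :
    (∃ (Φ : CMType K) (A : AbelianVariety ℂ) (ι' : 𝓞 K →+* End A) (θ' : K →+* Module.End ℂ (complexBetti A.X 1)),
      IsCMTypeRealisation Φ A ι' θ' ∧ A.IsSimple ∧ A.dim = 8 ∧ hodgeClassSpan 8 A.X 4 ≠ divisorClassesSpan A.X 8 4) ∧
    (∃ (Φ : CMType K) (A : AbelianVariety ℂ) (ι' : 𝓞 K →+* End A) (θ' : K →+* Module.End ℂ (complexBetti A.X 1)),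
      IsCMTypeRealisation Φ A ι' θ' ∧ A.IsSimple ∧ A.dim = 8 ∧ hodgeClassSpan 8 A.X 2 ≠ divisorClassesSpan A.X 8 2) ∧
    (∃ (Φ : CMType K) (A : AbelianVariety ℂ) (ι' : 𝓞 K →+* End A) (θ' : K →+* Module.End ℂ (complexBetti A.X 1)),
      IsCMTypeRealisation Φ A ι' θ' ∧ A.IsSimple ∧ A.dim = 8 ∧
        ∀ n : ℕ, HodgeConjectureFor (⨁ fun _ : Fin n => A).dim (⨁ fun _ : Fin n => A).X) := by
  haveI := isCMField₈ K
  obtain ⟨φ₀⟩ : Nonempty (K →+* ℂ) := inferInstance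
  obtain ⟨hrN0, hrN1, hrN2, hrN3, hrN4, hrN5, hrN6, hrN7, hrD0, hrD1, hrD2, hrD3, hrD4, hrD5, hrI0, hrI1, hrI2, hrI3, hrI4, hrI5⟩ := isCMResidueSet_reps_thirtyTwo
  obtain ⟨hpN0, hpN1, hpN2, hpN3, hpN4, hpN5, hpN6, hpN7, hpD0, hpD1, hpD2, hpD3, hpD4, hpD5⟩ := hasTrivialStabilizer_reps_thirtyTwo
  obtain ⟨hb0, hb1, hb2, hb3, hb4, hb5, hb6, hb7⟩ := cosetBalanced_reps_thirtyTwo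
  have hp : ∀ {Φ : CMType K}, HasTrivialStabilizer 32 (residueSet 32 Φ) → IsPrimitive (ℂ ≃+* ℂ) Φ.1 φ₀ :=
    fun {Φ} h ↦ (isPrimitive_iff_hasTrivialStabilizer 32 Φ φ₀).2 h
  refine ⟨?_, ?_, ?_⟩
  · obtain ⟨Φ, hr⟩ := exists_residueSet_eq_thirtyTwo (L := K) hrD0
    obtain ⟨A, ι', θ', hA⟩ := Literature.AlgebraicGeometry.ComplexMultiplication.exists_isCMTypeRealisation Φ
    have hpr : IsPrimitive (ℂ ≃+* ℂ) Φ.1 φ₀ := hp (by rw [hr]; exact hpD0)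
    have hbal : (∀ c ∈ unitResidues 32, ((({1, 3, 9, 11, 17, 19, 25, 27} : Finset (ZMod 32))).filter fun w => c * w ∈ residueSet 32 Φ).card = ((({1, 3, 9, 11, 17, 19, 25, 27} : Finset (ZMod 32))).filter fun w => c * w ∉ residueSet 32 Φ).card) ∨
      (∀ c ∈ unitResidues 32, ((({1, 5, 9, 13, 17, 21, 25, 29} : Finset (ZMod 32))).filter fun w => c * w ∈ residueSet 32 Φ).card = ((({1, 5, 9, 13, 17, 21, 25, 29} : Finset (ZMod 32))).filter fun w => c * w ∉ residueSet 32 Φ).card) :=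
      Or.inl (by rw [hr]; exact hb0)
    obtain ⟨hS, hd, ⟨c, hcQ, hcH, hcD⟩, -⟩ := exists_exceptional_four_of_cosetBalanced_thirtyTwo hK Φ φ₀ hpr hbal hA
    exact ⟨Φ, A, ι', θ', hA, hS, hd, fun h ↦ hcD (h ▸ Submodule.subset_span ⟨hcQ, hcH⟩)⟩
  · obtain ⟨Φ, hr⟩ := exists_residueSet_eq_thirtyTwo (L := K) hrD4
    obtain ⟨A, ι', θ', hA⟩ := Literature.AlgebraicGeometry.ComplexMultiplication.exists_isCMTypeRealisation Φ
    have hpr : IsPrimitive (ℂ ≃+* ℂ) Φ.1 φ₀ := hp (by rw [hr]; exact hpD4)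
    have hbal : (∀ c ∈ unitResidues 32, ((({1, 7, 17, 23} : Finset (ZMod 32))).filter fun w => c * w ∈ residueSet 32 Φ).card = ((({1, 7, 17, 23} : Finset (ZMod 32))).filter fun w => c * w ∉ residueSet 32 Φ).card) ∨
      (∀ c ∈ unitResidues 32, ((({1, 9, 17, 25} : Finset (ZMod 32))).filter fun w => c * w ∈ residueSet 32 Φ).card = ((({1, 9, 17, 25} : Finset (ZMod 32))).filter fun w => c * w ∉ residueSet 32 Φ).card) :=
      Or.inl (by rw [hr]; exact hb4)
    obtain ⟨hS, hd, ⟨c, hcQ, hcH, hcD⟩, -⟩ := exists_exceptional_two_of_cosetBalanced_thirtyTwo hK Φ φ₀ hpr hbal hA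
    exact ⟨Φ, A, ι', θ', hA, hS, hd, fun h ↦ hcD (h ▸ Submodule.subset_span ⟨hcQ, hcH⟩)⟩
  · obtain ⟨Φ, hr⟩ := exists_residueSet_eq_thirtyTwo (L := K) hrN0
    obtain ⟨A, ι', θ', hA⟩ := Literature.AlgebraicGeometry.ComplexMultiplication.exists_isCMTypeRealisation Φ
    have hpr : IsPrimitive (ℂ ≃+* ℂ) Φ.1 φ₀ := hp (by rw [hr]; exact hpN0)
    have hn : ¬((∀ c ∈ unitResidues 32, ((({1, 15} : Finset (ZMod 32))).filter fun w => c * w ∈ residueSet 32 Φ).card = ((({1, 15} : Finset (ZMod 32))).filter fun w => c * w ∉ residueSet 32 Φ).card) ∨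
      (∀ c ∈ unitResidues 32, ((({1, 7, 17, 23} : Finset (ZMod 32))).filter fun w => c * w ∈ residueSet 32 Φ).card = ((({1, 7, 17, 23} : Finset (ZMod 32))).filter fun w => c * w ∉ residueSet 32 Φ).card) ∨
      (∀ c ∈ unitResidues 32, ((({1, 3, 9, 11, 17, 19, 25, 27} : Finset (ZMod 32))).filter fun w => c * w ∈ residueSet 32 Φ).card = ((({1, 3, 9, 11, 17, 19, 25, 27} : Finset (ZMod 32))).filter fun w => c * w ∉ residueSet 32 Φ).card) ∨
      (∀ c ∈ unitResidues 32, ((({1, 5, 9, 13, 17, 21, 25, 29} : Finset (ZMod 32))).filter fun w => c * w ∈ residueSet 32 Φ).card = ((({1, 5, 9, 13, 17, 21, 25, 29} : Finset (ZMod 32))).filter fun w => c * w ∉ residueSet 32 Φ).card)) := by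
      rw [hr]; exact not_cosetBalanced_reps_thirtyTwo.1
    exact ⟨Φ, A, ι', θ', hA, isSimple_of_isCMTypeRealisation_of_isPrimitive hA φ₀ hpr, dim_eq_eight_of_isCMTypeRealisation_thirtyTwo hK hA,
      fun n ↦ hodgeConjectureFor_pow_of_thirtyTwo hK Φ φ₀ (fun _ ↦ hn) hA n⟩

end Varieties

/-! ### §3 Complex tori with an endomorphism of characteristic polynomial `Φ₃₂` -/

section Tori

variable {ι : Type} [Fintype ι] [DecidableEq ι] {E : Type} [NormedAddCommGroup E] [NormedSpace ℂ E]
  {P : (ι → ℝ) ≃L[ℝ] E}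

set_option backward.isDefEq.respectTransparency false in -- Mathlib's instance
-- `IsCyclotomicExtension {32} ℚ (CyclotomicField 32 ℚ)` is keyed on `CyclotomicField.algebra`, the goal on `DivisionRing.toRatAlgebra`
/-- **`rank MT(X) ∈ {9, 8, 7, 5, 3, 2}` FOR A COMPLEX TORUS WITH AN ENDOMORPHISM OF CHARACTERISTIC POLYNOMIAL `Φ₃₂`, and `X` is simple
iff `rank MT(X) ≥ 7`**: `X ≅ ℂ⁸/Φ(𝔞)` (structure theorem), `rank MT(X) = Rank(Φ)` (§1). [cite: Shimura1998, §6.2 Thm. 3] [cite: Gordon1999HodgeAVSurvey, §9.4] -/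
theorem mtRank_hodgeStructure_mem_and_isSimple_iff_thirtyTwo [HodgeTensorFacts.{0, 0}] {A : Matrix ι ι ℤ} (hA : A ∈ endRingInt P)
    (hP : A.charpoly = cyclotomic 32 ℤ) :
    ((hodgeStructure P 1).mtRank = 9 ∨ (hodgeStructure P 1).mtRank = 8 ∨ (hodgeStructure P 1).mtRank = 7 ∨ (hodgeStructure P 1).mtRank = 5 ∨ (hodgeStructure P 1).mtRank = 3 ∨ (hodgeStructure P 1).mtRank = 2) ∧
      (ComplexTorus.IsSimple P ↔ 7 ≤ (hodgeStructure P 1).mtRank) := by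
  have hζ := IsCyclotomicExtension.zeta_spec 32 ℚ (CyclotomicField 32 ℚ)
  obtain ⟨Φ, I, e, he, he₂, -⟩ := exists_cmType_ideal_iso_of_charpoly_eq_cyclotomic hζ hA hP
  haveI : IsCMField (CyclotomicField 32 ℚ) := isCMField₈ (CyclotomicField 32 ℚ)
  obtain ⟨φ₀⟩ : Nonempty (CyclotomicField 32 ℚ →+* ℂ) := inferInstance
  have hXiso : IsIsomorphic P (periodIso Φ I) := ⟨e, he, he₂⟩
  rw [IsIsomorphic.mtRank_hodgeStructure_eq P (periodIso Φ I) (k := 1) hXiso, mtRank_hodgeStructure_periodIso_eq_cmTypeRank Φ I,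
    hXiso.isSimple_iff, isSimple_periodIso_iff_isPrimitive Φ I φ₀]
  exact ⟨cmTypeRank_mem_thirtyTwo Φ, isPrimitive_iff_seven_le_cmTypeRank_thirtyTwo Φ φ₀⟩

set_option backward.isDefEq.respectTransparency false in -- see above
/-- **FOR `X` WITH `P_u = Φ₃₂`: `Hdg(Xᵏ) = Div(Xᵏ)` FOR ALL `k` ⟺ (`X` simple → `rank MT(X) = 9`)** — simple: Hazama–Murty's criterion `rank = dim + 1`;
non-simple: `X ≅ ℂ⁸/Φ(𝔞)` with `Φ` imprimitive, induced from a NONDEGENERATE type (§0–§1), so `Hdg = Div` on all powers.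
[cite: Gordon1999HodgeAVSurvey, 7.5 and §9.3] [cite: MoonenZarhin1999LowDim, §2 Thm. (2.7)] [cite: Shimura1998, §6.2 Thm. 3] -/
theorem forall_divisorClasses_powPeriod_eq_hodgeClasses_iff_thirtyTwo [HodgeTensorFacts.{0, 0}] {A : Matrix ι ι ℤ} (hA : A ∈ endRingInt P)
    (hP : A.charpoly = cyclotomic 32 ℤ) :
    (∀ k p : ℕ, divisorClasses (powPeriod P k) p = hodgeClasses (powPeriod P k) p) ↔
      (ComplexTorus.IsSimple P → (hodgeStructure P 1).mtRank = 9) := by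
  have hζ := IsCyclotomicExtension.zeta_spec 32 ℚ (CyclotomicField 32 ℚ)
  obtain ⟨Φ, I, e, he, he₂, -⟩ := exists_cmType_ideal_iso_of_charpoly_eq_cyclotomic hζ hA hP
  haveI : IsCMField (CyclotomicField 32 ℚ) := isCMField₈ (CyclotomicField 32 ℚ)
  obtain ⟨φ₀⟩ : Nonempty (CyclotomicField 32 ℚ →+* ℂ) := inferInstance
  have hXiso : IsIsomorphic P (periodIso Φ I) := ⟨e, he, he₂⟩
  have hcard : Fintype.card (basisIndex I) = 16 := by rw [card_basisIndex_eq_finrank, finrank_eq_sixteen₈ (CyclotomicField 32 ℚ)]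
  haveI : Nonempty (basisIndex I) := Fintype.card_pos_iff.1 (by omega)
  have hY := isAbelianVariety_periodIso Φ I
  rw [hXiso.isIsogenous.forall_powPeriod_divisorClasses_eq_hodgeClasses_iff, hXiso.isSimple_iff,
    IsIsomorphic.mtRank_hodgeStructure_eq P (periodIso Φ I) (k := 1) hXiso]
  by_cases hS : ComplexTorus.IsSimple (periodIso Φ I)
  · rw [hY.forall_powPeriod_divisorClasses_eq_hodgeClasses_iff_mtRank_eq_card_of_isSimple_of_isTorusSubgroup_mumfordTateGroupC hS
        (isTorusSubgroup_mumfordTateGroupC_periodIso Φ I), hcard]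
    simp only [hS, forall_true_left]
  · simp only [hS, false_implies, iff_true]
    have hnp : ¬IsPrimitive (ℂ ≃+* ℂ) Φ.1 φ₀ := fun h ↦ hS ((isSimple_periodIso_iff_isPrimitive Φ I φ₀).2 h)
    rcases cmTypeRank_of_not_isPrimitive_thirtyTwo Φ φ₀ hnp with ⟨hs, hr⟩ | ⟨hs, hr⟩ | ⟨hs, hr⟩
    · exact divisorClasses_powPeriod_periodIso_eq_hodgeClasses_of_card_stabilizer_mul_eq (N := 32) (by norm_num) Φ (k := 4)
        (by rw [hs]; decide +kernel) hr I
    · exact divisorClasses_powPeriod_periodIso_eq_hodgeClasses_of_card_stabilizer_mul_eq (N := 32) (by norm_num) Φ (k := 2)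
        (by rw [hs]; decide +kernel) hr I
    · exact divisorClasses_powPeriod_periodIso_eq_hodgeClasses_of_card_stabilizer_mul_eq (N := 32) (by norm_num) Φ (k := 1)
        (by rw [hs]; decide +kernel) hr I

/-- **`Hdg(Xᵏ) = Div(Xᵏ)` for all `k` when `X` is not simple or `rank MT(X) = 9`.** [cite: Gordon1999HodgeAVSurvey, 7.5] [cite: MoonenZarhin1999LowDim, §2 (2.7)] -/
theorem divisorClasses_powPeriod_eq_hodgeClasses_of_thirtyTwo [HodgeTensorFacts.{0, 0}] {A : Matrix ι ι ℤ} (hA : A ∈ endRingInt P)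
    (hP : A.charpoly = cyclotomic 32 ℤ) (h : ComplexTorus.IsSimple P → (hodgeStructure P 1).mtRank = 9) (k p : ℕ) :
    divisorClasses (powPeriod P k) p = hodgeClasses (powPeriod P k) p :=
  (forall_divisorClasses_powPeriod_eq_hodgeClasses_iff_thirtyTwo hA hP).2 h k p

set_option backward.isDefEq.respectTransparency false in -- see above
/-- **EACH PRIMITIVE RANK OCCURS AMONG SIMPLE ABELIAN `8`-FOLDS WITH `u = ζ₃₂`**: for a type `Φ` whose residue set is a representative of rank
`9, 8, 7` and any ideal `𝔞`, the torus `ℂ⁸/Φ(𝔞)` is a simple abelian variety with the endomorphism `ζ₃₂` and `rank MT = Rank(Φ)`; only for rank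
`9` is `Hdg = Div` on all powers. [cite: Shimura1998, §6.2 Thm. 3] [cite: Gordon1999HodgeAVSurvey, 7.5 and §9.4.2] -/
theorem exists_isSimple_mtRank_eq_thirtyTwo [HodgeTensorFacts.{0, 0}] :
    (∃ Φ : CMType (CyclotomicField 32 ℚ), ∀ I : (FractionalIdeal (𝓞 (CyclotomicField 32 ℚ))⁰ (CyclotomicField 32 ℚ))ˣ,
      ComplexTorus.IsSimple (periodIso Φ I) ∧ IsAbelianVariety (periodIso Φ I) ∧
      (∃ A ∈ endRingInt (periodIso Φ I), A.charpoly = cyclotomic 32 ℤ) ∧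
      (hodgeStructure (periodIso Φ I) 1).mtRank = 9) ∧
    (∃ Φ : CMType (CyclotomicField 32 ℚ), ∀ I : (FractionalIdeal (𝓞 (CyclotomicField 32 ℚ))⁰ (CyclotomicField 32 ℚ))ˣ,
      ComplexTorus.IsSimple (periodIso Φ I) ∧ IsAbelianVariety (periodIso Φ I) ∧
      (∃ A ∈ endRingInt (periodIso Φ I), A.charpoly = cyclotomic 32 ℤ) ∧
      (hodgeStructure (periodIso Φ I) 1).mtRank = 8) ∧
    (∃ Φ : CMType (CyclotomicField 32 ℚ), ∀ I : (FractionalIdeal (𝓞 (CyclotomicField 32 ℚ))⁰ (CyclotomicField 32 ℚ))ˣ,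
      ComplexTorus.IsSimple (periodIso Φ I) ∧ IsAbelianVariety (periodIso Φ I) ∧
      (∃ A ∈ endRingInt (periodIso Φ I), A.charpoly = cyclotomic 32 ℤ) ∧
      (hodgeStructure (periodIso Φ I) 1).mtRank = 7) := by
  have hζ := IsCyclotomicExtension.zeta_spec 32 ℚ (CyclotomicField 32 ℚ)
  haveI : IsCMField (CyclotomicField 32 ℚ) := isCMField₈ (CyclotomicField 32 ℚ)
  obtain ⟨φ₀⟩ : Nonempty (CyclotomicField 32 ℚ →+* ℂ) := inferInstance
  obtain ⟨hrN0, hrN1, hrN2, hrN3, hrN4, hrN5, hrN6, hrN7, hrD0, hrD1, hrD2, hrD3, hrD4, hrD5, hrI0, hrI1, hrI2, hrI3, hrI4, hrI5⟩ := isCMResidueSet_reps_thirtyTwo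
  obtain ⟨hpN0, hpN1, hpN2, hpN3, hpN4, hpN5, hpN6, hpN7, hpD0, hpD1, hpD2, hpD3, hpD4, hpD5⟩ := hasTrivialStabilizer_reps_thirtyTwo
  have hend : ∀ (Φ : CMType (CyclotomicField 32 ℚ)) (I : (FractionalIdeal (𝓞 (CyclotomicField 32 ℚ))⁰ (CyclotomicField 32 ℚ))ˣ),
      ∃ A ∈ endRingInt (periodIso Φ I), A.charpoly = cyclotomic 32 ℤ :=
    fun Φ I ↦ ⟨Literature.NumberTheory.ComplexMultiplication.CMTypeLattice.mulMatrix I hζ.toInteger,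
      mulMatrix_toInteger_mem_endRingInt hζ Φ I, charpoly_mulMatrix_toInteger hζ I⟩
  have hsimple : ∀ {Φ : CMType (CyclotomicField 32 ℚ)}, HasTrivialStabilizer 32 (residueSet 32 Φ) →
      ∀ I, ComplexTorus.IsSimple (periodIso Φ I) := fun {Φ} hΦ I ↦
    (isSimple_periodIso_iff_isPrimitive Φ I φ₀).2 ((isPrimitive_iff_hasTrivialStabilizer 32 Φ φ₀).2 hΦ)
  refine ⟨?_, ?_, ?_⟩
  · obtain ⟨Φ, hr⟩ := exists_residueSet_eq_thirtyTwo (L := CyclotomicField 32 ℚ) hrN0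
    refine ⟨Φ, fun I ↦ ⟨hsimple (by rw [hr]; exact hpN0) I, isAbelianVariety_periodIso Φ I, hend Φ I, ?_⟩⟩
    rw [mtRank_hodgeStructure_periodIso_eq_cmTypeRank Φ I]
    exact cmTypeRank_eq_nine_of_residueSet_mem_thirtyTwo Φ (by rw [hr]; simp)
  · obtain ⟨Φ, hr⟩ := exists_residueSet_eq_thirtyTwo (L := CyclotomicField 32 ℚ) hrD0
    refine ⟨Φ, fun I ↦ ⟨hsimple (by rw [hr]; exact hpD0) I, isAbelianVariety_periodIso Φ I, hend Φ I, ?_⟩⟩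
    rw [mtRank_hodgeStructure_periodIso_eq_cmTypeRank Φ I]
    exact cmTypeRank_eq_of_residueSet_eq_D1_thirtyTwo Φ hr
  · obtain ⟨Φ, hr⟩ := exists_residueSet_eq_thirtyTwo (L := CyclotomicField 32 ℚ) hrD4
    refine ⟨Φ, fun I ↦ ⟨hsimple (by rw [hr]; exact hpD4) I, isAbelianVariety_periodIso Φ I, hend Φ I, ?_⟩⟩
    rw [mtRank_hodgeStructure_periodIso_eq_cmTypeRank Φ I]
    exact cmTypeRank_eq_of_residueSet_eq_D5_thirtyTwo Φ hr

end Tori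

end ComplexTorus

end Literature.Geometry.Kaehler

end
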